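import Mathlib.Analysis.Calculus.ContDiff.Basic
import Mathlib.Analysis.Calculus.FDeriv.Equiv
import Mathlib.Analysis.Calculus.Deriv.Comp
import Mathlib.Analysis.Calculus.Deriv.Mul
import Mathlib.Analysis.Calculus.Deriv.Add
import Mathlib.Analysis.Calculus.Deriv.Prod
import Mathlib.Analysis.InnerProductSpace.PiL2
import Mathlib.MeasureTheory.Integral.IntegralEqImproper
import Mathlib.MeasureTheory.Integral.Prod
import Mathlib.MeasureTheory.Measure.Haar.InnerProductSpace
import Mathlib.MeasureTheory.Measure.Lebesgue.EqHaar
import Mathlib.MeasureTheory.Group.Measure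
import Mathlib.Topology.Algebra.Module.Equiv
import HarnessLib

/-!
# Rankine–Hugoniot bookkeeping on a fan partition of space–time `ℝ × ℝ²`

Topic `Analysis/FluidPDE`; pure Mathlib calculus, no definitions (a proof-only support file for
`Literature/Barriers/AtomisticToContinuum/WildSolutionsProofs.lean`).

A *fan partition* (Markfelder, LNM 2294 (2021), Def. 7.3.2 / Def. 8.3.2; Chiodaroli–De Lellis–
Kreml 2015, Def. 3.3) of `(0, ∞) × ℝ²` consists of the open regions
`Γ₋ = {t > 0, y < μ₀ t}`, `Γᵢ = {t > 0, μ_{i-1} t < y < μᵢ t}`, `Γ₊ = {t > 0, y > μ_N t}`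
(coordinates `(t, x, y)`; the regions do not depend on `x`). A *fan subsolution* is piecewise
constant on such a partition, and its weak (distributional) balance laws reduce to the
Rankine–Hugoniot conditions across the rays `y = μᵢ t` (Markfelder 2021, Prop. 7.3.5 and
Prop. 8.3.5; CDK 2015, §3). This file proves that reduction for the three-region symmetric fan
`y < -σt`, `-σt < y < σt`, `y > σt` used by the barrier `WildSolutionsBarrier`:

* `fan_identity`: for constant densities/`x`-fluxes/`y`-fluxes `(q, g, f)` on the three regions
  and the Riemann datum `q₋ 1_{y<0} + q₊ 1_{y≥0}`, and every `φ ∈ C¹_c(ℝ × ℝ²)`,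
  `Σ_R ∫_{Γ_R} (q_R ∂ₜφ + g_R ∂ₓφ + f_R ∂_yφ) + ∫ q_init φ(0, ·)
   = [(f₋ - f₁) + σ(q₋ - q₁)] B(-σ) + [(f₁ - f₊) + σ(q₊ - q₁)] B(σ)`,
  `B(μ) = ∫∫_{t>0} φ(t, x, μt) dx dt ≥ 0` for `φ ≥ 0`; hence the weak form vanishes under the
  Rankine–Hugoniot equalities (`fan_weakForm_eq_zero`) and is `≤ 0` against non-negative test
  functions under the Rankine–Hugoniot inequalities (`fan_weakForm_nonpos`);
* `setIntegral_halfSpace_eq_fan`: `∫_{t>0} = ∫_{Γ₋} + ∫_{Γ₁} + ∫_{Γ₊}` (the rays are null).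

Method: slice in `x` (the regions are `x`-independent and `∫ ∂ₓφ dx = 0`), and in the
`(t, y)`-plane reduce every region to the quadrant `{t > 0, y < 0}` (shear `y ↦ y - μt`,
reflection `y ↦ -y`, inclusion–exclusion for the middle wedge), where Fubini and the
one-variable fundamental theorem of calculus on half-lines apply. All statements are about
`fderiv` in the coordinate directions `(1, 0)`, `(0, e₀)`, `(0, e₁)` of `ℝ × ℝ²`,
`ℝ² = EuclideanSpace ℝ (Fin 2)` with points written `x e₀ + y e₁ = single 0 x + single 1 y`.

## References

* S. Markfelder, *Convex Integration Applied to the Multi-Dimensional Compressible Euler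
  Equations*, LNM 2294 (2021), Def. 7.3.2, Def. 8.3.2, Prop. 7.3.5, Prop. 8.3.5.
* E. Chiodaroli, C. De Lellis, O. Kreml, Comm. Pure Appl. Math. 68 (2015) 1157–1190, §3.
-/

open MeasureTheory Set Filter Topology

namespace Literature.Analysis.FluidPDE.FanPartition

variable {Ψ : ℝ × ℝ → ℝ}

/-- A compactly supported function on `ℝ²` and its derivative vanish outside a large ball. [folklore] -/
theorem exists_radius (hΨc : HasCompactSupport Ψ) :
    ∃ R : ℝ, 0 < R ∧ ∀ p : ℝ × ℝ, R < ‖p‖ → Ψ p = 0 ∧ fderiv ℝ Ψ p = 0 := by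
  obtain ⟨r, hr⟩ := hΨc.isCompact.isBounded.subset_closedBall (0 : ℝ × ℝ)
  refine ⟨max r 1, lt_max_of_lt_right one_pos, fun p hp => ?_⟩
  have hp' : p ∉ tsupport Ψ := by
    intro h
    have := hr h
    rw [Metric.mem_closedBall, dist_zero_right] at this
    exact absurd (lt_of_le_of_lt (le_max_left r 1) hp) (not_lt.mpr this)
  refine ⟨image_eq_zero_of_notMem_tsupport hp', ?_⟩
  have : p ∉ tsupport (fderiv ℝ Ψ) := fun h => hp' (tsupport_fderiv_subset ℝ h)
  exact image_eq_zero_of_notMem_tsupport this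

/-- Derivative of a `C¹` function of `ℝ²` along the horizontal line through `(t, y)`. [folklore] -/
theorem hasDerivAt_line_t (hΨ : ContDiff ℝ 1 Ψ) (t y : ℝ) :
    HasDerivAt (fun s => Ψ (s, y)) (fderiv ℝ Ψ (t, y) (1, 0)) t := by
  have h1 : HasFDerivAt Ψ (fderiv ℝ Ψ (t, y)) (t, y) :=
    ((hΨ.differentiable one_ne_zero) (t, y)).hasFDerivAt
  have h2 : HasDerivAt (fun s : ℝ => ((s, y) : ℝ × ℝ)) ((1 : ℝ), (0 : ℝ)) t :=
    (hasDerivAt_id t).prodMk (hasDerivAt_const t y)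
  exact h1.comp_hasDerivAt t h2

/-- Derivative of a `C¹` function of `ℝ²` along the vertical line through `(t, y)`. [folklore] -/
theorem hasDerivAt_line_y (hΨ : ContDiff ℝ 1 Ψ) (t y : ℝ) :
    HasDerivAt (fun s => Ψ (t, s)) (fderiv ℝ Ψ (t, y) (0, 1)) y := by
  have h1 : HasFDerivAt Ψ (fderiv ℝ Ψ (t, y)) (t, y) :=
    ((hΨ.differentiable one_ne_zero) (t, y)).hasFDerivAt
  have h2 : HasDerivAt (fun s : ℝ => ((t, s) : ℝ × ℝ)) ((0 : ℝ), (1 : ℝ)) y :=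
    (hasDerivAt_const y t).prodMk (hasDerivAt_id y)
  exact h1.comp_hasDerivAt y h2

/-- A directional derivative of a `C¹` function is continuous. [folklore] -/
theorem continuous_fderiv_apply (hΨ : ContDiff ℝ 1 Ψ) (v : ℝ × ℝ) :
    Continuous fun p => fderiv ℝ Ψ p v :=
  (hΨ.continuous_fderiv one_ne_zero).clm_apply continuous_const


/-- A continuous function on `ℝ × ℝ` vanishing outside the ball of radius `R` has integrable
horizontal and vertical line restrictions. [folklore] -/
theorem integrable_line_fst {F : ℝ × ℝ → ℝ} (hF : Continuous F) {R : ℝ}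
    (hR : ∀ p : ℝ × ℝ, R < ‖p‖ → F p = 0) (y : ℝ) : Integrable (fun t : ℝ => F (t, y)) := by
  refine Continuous.integrable_of_hasCompactSupport (by fun_prop) ?_
  refine HasCompactSupport.intro (isCompact_Icc : IsCompact (Icc (-R) R)) (fun t ht => hR _ ?_)
  refine lt_of_lt_of_le ?_ (norm_fst_le (t, y))
  simp only [mem_Icc, not_and_or, not_le] at ht
  rw [Real.norm_eq_abs]
  rcases ht with h | h
  · linarith [neg_abs_le t]
  · linarith [le_abs_self t]

/-- Vertical line restrictions of a continuous function vanishing outside a ball are integrable. [folklore] -/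
theorem integrable_line_snd {F : ℝ × ℝ → ℝ} (hF : Continuous F) {R : ℝ}
    (hR : ∀ p : ℝ × ℝ, R < ‖p‖ → F p = 0) (t : ℝ) : Integrable (fun s : ℝ => F (t, s)) := by
  refine Continuous.integrable_of_hasCompactSupport (by fun_prop) ?_
  refine HasCompactSupport.intro (isCompact_Icc : IsCompact (Icc (-R) R)) (fun s hs => hR _ ?_)
  refine lt_of_lt_of_le ?_ (norm_snd_le (t, s))
  simp only [mem_Icc, not_and_or, not_le] at hs
  rw [Real.norm_eq_abs]
  rcases hs with h | h
  · linarith [neg_abs_le s]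
  · linarith [le_abs_self s]

/-- A function vanishing outside a ball tends to `0` along horizontal lines. [folklore] -/
theorem tendsto_line_fst_atTop {F : ℝ × ℝ → ℝ} {R : ℝ}
    (hR : ∀ p : ℝ × ℝ, R < ‖p‖ → F p = 0) (y : ℝ) :
    Tendsto (fun t : ℝ => F (t, y)) atTop (𝓝 0) := by
  refine tendsto_const_nhds.congr' ?_
  filter_upwards [eventually_gt_atTop (max R 0)] with t ht
  refine (hR _ (lt_of_lt_of_le ?_ (norm_fst_le (t, y)))).symm
  rw [Real.norm_eq_abs, abs_of_pos (lt_of_le_of_lt (le_max_right R 0) ht)]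
  exact lt_of_le_of_lt (le_max_left R 0) ht

/-- A function vanishing outside a ball tends to `0` along vertical lines (downwards). [folklore] -/
theorem tendsto_line_snd_atBot {F : ℝ × ℝ → ℝ} {R : ℝ}
    (hR : ∀ p : ℝ × ℝ, R < ‖p‖ → F p = 0) (t : ℝ) :
    Tendsto (fun s : ℝ => F (t, s)) atBot (𝓝 0) := by
  refine tendsto_const_nhds.congr' ?_
  filter_upwards [eventually_lt_atBot (min (-R) 0)] with s hs
  refine (hR _ (lt_of_lt_of_le ?_ (norm_snd_le (t, s)))).symm
  rw [Real.norm_eq_abs, abs_of_neg (lt_of_lt_of_le hs (min_le_right _ _))]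
  linarith [min_le_left (-R) 0]

/-- A function vanishing outside a ball tends to `0` along vertical lines (upwards). [folklore] -/
theorem tendsto_line_snd_atTop {F : ℝ × ℝ → ℝ} {R : ℝ}
    (hR : ∀ p : ℝ × ℝ, R < ‖p‖ → F p = 0) (t : ℝ) :
    Tendsto (fun s : ℝ => F (t, s)) atTop (𝓝 0) := by
  refine tendsto_const_nhds.congr' ?_
  filter_upwards [eventually_gt_atTop (max R 0)] with s hs
  refine (hR _ (lt_of_lt_of_le ?_ (norm_snd_le (t, s)))).symm
  rw [Real.norm_eq_abs, abs_of_pos (lt_of_le_of_lt (le_max_right R 0) hs)]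
  exact lt_of_le_of_lt (le_max_left R 0) hs

/-- `∫_{t > 0} ∂ₜΨ(t, y) dt = -Ψ(0, y)`. [folklore] -/
theorem integral_Ioi_fderiv_fst (hΨ : ContDiff ℝ 1 Ψ) (hΨc : HasCompactSupport Ψ) (y : ℝ) :
    ∫ t in Ioi (0 : ℝ), fderiv ℝ Ψ (t, y) (1, 0) = -Ψ (0, y) := by
  obtain ⟨R, -, hR⟩ := exists_radius hΨc
  have h := integral_Ioi_of_hasDerivAt_of_tendsto (a := 0) (m := 0) (f := fun t => Ψ (t, y))
    (f' := fun t => fderiv ℝ Ψ (t, y) (1, 0))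
    ((hΨ.continuous.comp (by fun_prop : Continuous fun t : ℝ => (t, y))).continuousWithinAt)
    (fun t _ => hasDerivAt_line_t hΨ t y)
    ((integrable_line_fst (continuous_fderiv_apply hΨ (1, 0)) (fun p hp => (hR p hp).2 ▸ rfl)
      y).integrableOn)
    (tendsto_line_fst_atTop (fun p hp => (hR p hp).1) y)
  rw [h]; ring

/-- `∫_{s < c} ∂_yΨ(t, s) ds = Ψ(t, c)`. [folklore] -/
theorem integral_Iio_fderiv_snd (hΨ : ContDiff ℝ 1 Ψ) (hΨc : HasCompactSupport Ψ) (t c : ℝ) :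
    ∫ s in Iio c, fderiv ℝ Ψ (t, s) (0, 1) = Ψ (t, c) := by
  obtain ⟨R, -, hR⟩ := exists_radius hΨc
  rw [← integral_Iic_eq_integral_Iio]
  have h := integral_Iic_of_hasDerivAt_of_tendsto (a := c) (m := 0) (f := fun s => Ψ (t, s))
    (f' := fun s => fderiv ℝ Ψ (t, s) (0, 1))
    ((hΨ.continuous.comp (by fun_prop : Continuous fun s : ℝ => (t, s))).continuousWithinAt)
    (fun s _ => hasDerivAt_line_y hΨ t s)
    ((integrable_line_snd (continuous_fderiv_apply hΨ (0, 1)) (fun p hp => (hR p hp).2 ▸ rfl)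
      t).integrableOn)
    (tendsto_line_snd_atBot (fun p hp => (hR p hp).1) t)
  rw [h]; ring

/-- `∫_ℝ ∂_yΨ(t, s) ds = 0`. [folklore] -/
theorem integral_fderiv_snd_eq_zero (hΨ : ContDiff ℝ 1 Ψ) (hΨc : HasCompactSupport Ψ) (t : ℝ) :
    ∫ s, fderiv ℝ Ψ (t, s) (0, 1) = 0 := by
  obtain ⟨R, -, hR⟩ := exists_radius hΨc
  exact integral_eq_zero_of_hasDerivAt_of_integrable (f := fun s => Ψ (t, s))
    (fun s => hasDerivAt_line_y hΨ t s)
    (integrable_line_snd (continuous_fderiv_apply hΨ (0, 1)) (fun p hp => (hR p hp).2 ▸ rfl) t)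
    (integrable_line_snd hΨ.continuous (fun p hp => (hR p hp).1) t)

/-- `∫_ℝ ∂ₜΨ(t, y) dt = 0`. [folklore] -/
theorem integral_fderiv_fst_eq_zero (hΨ : ContDiff ℝ 1 Ψ) (hΨc : HasCompactSupport Ψ) (y : ℝ) :
    ∫ t, fderiv ℝ Ψ (t, y) (1, 0) = 0 := by
  obtain ⟨R, -, hR⟩ := exists_radius hΨc
  exact integral_eq_zero_of_hasDerivAt_of_integrable (f := fun t => Ψ (t, y))
    (fun t => hasDerivAt_line_t hΨ t y)
    (integrable_line_fst (continuous_fderiv_apply hΨ (1, 0)) (fun p hp => (hR p hp).2 ▸ rfl) y)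
    (integrable_line_fst hΨ.continuous (fun p hp => (hR p hp).1) y)

/-- Directional derivatives of a `C¹_c` function on `ℝ²` are integrable. [folklore] -/
theorem integrable_fderiv_apply (hΨ : ContDiff ℝ 1 Ψ) (hΨc : HasCompactSupport Ψ) (v : ℝ × ℝ) :
    Integrable (fun p => fderiv ℝ Ψ p v) :=
  (continuous_fderiv_apply hΨ v).integrable_of_hasCompactSupport (hΨc.fderiv_apply ℝ v)

/-- **Quadrant lemma.** For `Ψ ∈ C¹_c(ℝ²)`:
`∫_{t>0, y<0} (q ∂ₜΨ + f ∂_yΨ) = -q ∫_{y<0} Ψ(0, y) dy + f ∫_{t>0} Ψ(t, 0) dt`. [folklore] -/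
theorem setIntegral_quadrant (hΨ : ContDiff ℝ 1 Ψ) (hΨc : HasCompactSupport Ψ) (q f : ℝ) :
    ∫ p in Ioi (0 : ℝ) ×ˢ Iio (0 : ℝ), (q * fderiv ℝ Ψ p (1, 0) + f * fderiv ℝ Ψ p (0, 1)) =
      -q * (∫ y in Iio (0 : ℝ), Ψ (0, y)) + f * ∫ t in Ioi (0 : ℝ), Ψ (t, 0) := by
  have hI1 := (integrable_fderiv_apply hΨ hΨc (1, 0)).integrableOn (s := Ioi (0 : ℝ) ×ˢ Iio (0 : ℝ))
  have hI2 := (integrable_fderiv_apply hΨ hΨc (0, 1)).integrableOn (s := Ioi (0 : ℝ) ×ˢ Iio (0 : ℝ))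
  rw [integral_add (hI1.const_mul q) (hI2.const_mul f), integral_const_mul, integral_const_mul]
  congr 1
  · have hsw : Integrable (fun p : ℝ × ℝ => fderiv ℝ Ψ p.swap (1, 0)) :=
      ((continuous_fderiv_apply hΨ (1, 0)).comp continuous_swap).integrable_of_hasCompactSupport
        ((hΨc.fderiv_apply ℝ (1, 0)).comp_homeomorph (Homeomorph.prodComm ℝ ℝ))
    have hI1' : IntegrableOn (fun p : ℝ × ℝ => fderiv ℝ Ψ p.swap (1, 0)) (Iio (0 : ℝ) ×ˢ Ioi (0 : ℝ))
        ((volume : Measure ℝ).prod volume) := hsw.integrableOn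
    rw [Measure.volume_eq_prod, ← setIntegral_prod_swap, setIntegral_prod _ hI1']
    simp only [Prod.swap_prod_mk]
    rw [neg_mul, ← mul_neg, ← integral_neg]
    congr 1
    refine setIntegral_congr_fun measurableSet_Iio (fun y _ => ?_)
    exact integral_Ioi_fderiv_fst hΨ hΨc y
  · rw [Measure.volume_eq_prod, setIntegral_prod _ (by rwa [Measure.volume_eq_prod] at hI2)]
    congr 1
    refine setIntegral_congr_fun measurableSet_Ioi (fun t _ => ?_)
    exact integral_Iio_fderiv_snd hΨ hΨc t 0

/-- **Half-plane lemma.** For `Ψ ∈ C¹_c(ℝ²)`: `∫_{t>0} (q ∂ₜΨ + f ∂_yΨ) = -q ∫ Ψ(0, y) dy`. [folklore] -/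
theorem setIntegral_halfPlane (hΨ : ContDiff ℝ 1 Ψ) (hΨc : HasCompactSupport Ψ) (q f : ℝ) :
    ∫ p in Ioi (0 : ℝ) ×ˢ (univ : Set ℝ), (q * fderiv ℝ Ψ p (1, 0) + f * fderiv ℝ Ψ p (0, 1)) =
      -q * ∫ y, Ψ (0, y) := by
  have hI1 := (integrable_fderiv_apply hΨ hΨc (1, 0)).integrableOn (s := Ioi (0 : ℝ) ×ˢ (univ : Set ℝ))
  have hI2 := (integrable_fderiv_apply hΨ hΨc (0, 1)).integrableOn (s := Ioi (0 : ℝ) ×ˢ (univ : Set ℝ))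
  rw [integral_add (hI1.const_mul q) (hI2.const_mul f), integral_const_mul, integral_const_mul]
  have h2 : ∫ p in Ioi (0 : ℝ) ×ˢ (univ : Set ℝ), fderiv ℝ Ψ p (0, 1) = 0 := by
    rw [Measure.volume_eq_prod, setIntegral_prod _ (by rwa [Measure.volume_eq_prod] at hI2)]
    refine setIntegral_eq_zero_of_forall_eq_zero (fun t _ => ?_)
    rw [setIntegral_univ]
    exact integral_fderiv_snd_eq_zero hΨ hΨc t
  rw [h2, mul_zero, add_zero]
  have hsw : Integrable (fun p : ℝ × ℝ => fderiv ℝ Ψ p.swap (1, 0)) :=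
    ((continuous_fderiv_apply hΨ (1, 0)).comp continuous_swap).integrable_of_hasCompactSupport
      ((hΨc.fderiv_apply ℝ (1, 0)).comp_homeomorph (Homeomorph.prodComm ℝ ℝ))
  have hI1' : IntegrableOn (fun p : ℝ × ℝ => fderiv ℝ Ψ p.swap (1, 0)) ((univ : Set ℝ) ×ˢ Ioi (0 : ℝ))
      ((volume : Measure ℝ).prod volume) := hsw.integrableOn
  rw [Measure.volume_eq_prod, ← setIntegral_prod_swap, setIntegral_prod _ hI1']
  simp only [Prod.swap_prod_mk]
  rw [neg_mul, ← mul_neg, ← integral_neg, setIntegral_univ]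
  congr 1
  refine integral_congr_ae (Filter.Eventually.of_forall fun y => ?_)
  exact integral_Ioi_fderiv_fst hΨ hΨc y

/-- The shear `(t, y) ↦ (t, y + μ t)` preserves Lebesgue measure on `ℝ²`. [folklore] -/
theorem measurePreserving_shear (μ : ℝ) :
    MeasurePreserving (fun p : ℝ × ℝ => (p.1, p.2 + μ * p.1)) := by
  have h := (MeasurePreserving.id (volume : Measure ℝ)).skew_product
    (μc := (volume : Measure ℝ)) (μd := (volume : Measure ℝ))
    (g := fun t y => y + μ * t) (by fun_prop)
    (ae_of_all _ fun t => (measurePreserving_add_right volume (μ * t)).map_eq)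
  rw [Measure.volume_eq_prod]
  simpa using h

/-- **Half-wedge lemma.** For `Ψ ∈ C¹_c(ℝ²)` and the half-wedge `H_μ = {t > 0, y < μ t}`:
`∫_{H_μ} (q ∂ₜΨ + f ∂_yΨ) = -q ∫_{y<0} Ψ(0, y) dy + (f - q μ) ∫_{t>0} Ψ(t, μ t) dt`. [folklore] -/
theorem setIntegral_halfWedge (hΨ : ContDiff ℝ 1 Ψ) (hΨc : HasCompactSupport Ψ) (μ q f : ℝ) :
    ∫ p in {p : ℝ × ℝ | 0 < p.1 ∧ p.2 < μ * p.1},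
        (q * fderiv ℝ Ψ p (1, 0) + f * fderiv ℝ Ψ p (0, 1)) =
      -q * (∫ y in Iio (0 : ℝ), Ψ (0, y)) + (f - q * μ) * ∫ t in Ioi (0 : ℝ), Ψ (t, μ * t) := by
  set iso : (ℝ × ℝ) ≃L[ℝ] (ℝ × ℝ) := (ContinuousLinearEquiv.refl ℝ ℝ).skewProd
    (ContinuousLinearEquiv.refl ℝ ℝ) (μ • ContinuousLinearMap.id ℝ ℝ) with hiso_def
  have hiso : ∀ p : ℝ × ℝ, iso p = (p.1, p.2 + μ * p.1) := fun p => by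
    simp [iso, ContinuousLinearEquiv.skewProd_apply]
  have hmp : MeasurePreserving (iso : ℝ × ℝ → ℝ × ℝ) := by
    have := measurePreserving_shear μ
    convert this using 1
    ext1 p; exact hiso p
  have hemb : MeasurableEmbedding (iso : ℝ × ℝ → ℝ × ℝ) := iso.toHomeomorph.measurableEmbedding
  have hpre : (iso : ℝ × ℝ → ℝ × ℝ) ⁻¹' {p : ℝ × ℝ | 0 < p.1 ∧ p.2 < μ * p.1} =
      Ioi (0 : ℝ) ×ˢ Iio (0 : ℝ) := by
    ext ⟨t, y⟩
    simp [hiso]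
  rw [← hmp.setIntegral_preimage_emb hemb
    (fun p => q * fderiv ℝ Ψ p (1, 0) + f * fderiv ℝ Ψ p (0, 1)) {p | 0 < p.1 ∧ p.2 < μ * p.1}, hpre]
  -- the sheared test function
  have hΨ' : ContDiff ℝ 1 (Ψ ∘ iso) := hΨ.comp iso.contDiff
  have hΨ'c : HasCompactSupport (Ψ ∘ iso) := hΨc.comp_homeomorph iso.toHomeomorph
  have hd1 : ∀ p : ℝ × ℝ, fderiv ℝ (Ψ ∘ iso) p (1, 0) =
      fderiv ℝ Ψ (iso p) (1, 0) + μ * fderiv ℝ Ψ (iso p) (0, 1) := by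
    intro p
    rw [iso.comp_right_fderiv, ContinuousLinearMap.comp_apply]
    have : ((iso : ℝ × ℝ →L[ℝ] ℝ × ℝ) (1, 0) : ℝ × ℝ) = (1, 0) + μ • ((0 : ℝ), (1 : ℝ)) := by
      rw [ContinuousLinearEquiv.coe_coe, hiso]; ext <;> simp
    rw [this, map_add, map_smul, smul_eq_mul]
  have hd2 : ∀ p : ℝ × ℝ, fderiv ℝ (Ψ ∘ iso) p (0, 1) = fderiv ℝ Ψ (iso p) (0, 1) := by
    intro p
    rw [iso.comp_right_fderiv, ContinuousLinearMap.comp_apply]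
    have : ((iso : ℝ × ℝ →L[ℝ] ℝ × ℝ) (0, 1) : ℝ × ℝ) = (0, 1) := by
      rw [ContinuousLinearEquiv.coe_coe, hiso]; simp
    rw [this]
  have key : ∀ p : ℝ × ℝ, q * fderiv ℝ Ψ (iso p) (1, 0) + f * fderiv ℝ Ψ (iso p) (0, 1) =
      q * fderiv ℝ (Ψ ∘ iso) p (1, 0) + (f - q * μ) * fderiv ℝ (Ψ ∘ iso) p (0, 1) := by
    intro p; rw [hd1, hd2]; ring
  simp_rw [key]
  rw [setIntegral_quadrant hΨ' hΨ'c q (f - q * μ)]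
  simp [Function.comp, hiso]

/-- The reflection `(t, y) ↦ (t, -y)` preserves Lebesgue measure on `ℝ²`. [folklore] -/
theorem measurePreserving_reflect :
    MeasurePreserving (fun p : ℝ × ℝ => (p.1, -p.2)) := by
  have h := (MeasurePreserving.id (volume : Measure ℝ)).prod (Measure.measurePreserving_neg (volume : Measure ℝ))
  rw [Measure.volume_eq_prod]
  exact h

/-- **Upper half-wedge lemma.** For `Ψ ∈ C¹_c(ℝ²)` and `U_μ = {t > 0, y > μ t}`:
`∫_{U_μ} (q ∂ₜΨ + f ∂_yΨ) = -q ∫_{y>0} Ψ(0, y) dy - (f - q μ) ∫_{t>0} Ψ(t, μ t) dt`. [folklore] -/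
theorem setIntegral_upperHalfWedge (hΨ : ContDiff ℝ 1 Ψ) (hΨc : HasCompactSupport Ψ) (μ q f : ℝ) :
    ∫ p in {p : ℝ × ℝ | 0 < p.1 ∧ μ * p.1 < p.2},
        (q * fderiv ℝ Ψ p (1, 0) + f * fderiv ℝ Ψ p (0, 1)) =
      -q * (∫ y in Ioi (0 : ℝ), Ψ (0, y)) - (f - q * μ) * ∫ t in Ioi (0 : ℝ), Ψ (t, μ * t) := by
  set iso : (ℝ × ℝ) ≃L[ℝ] (ℝ × ℝ) :=
    (ContinuousLinearEquiv.refl ℝ ℝ).prodCongr (ContinuousLinearEquiv.neg ℝ) with hiso_def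
  have hiso : ∀ p : ℝ × ℝ, iso p = (p.1, -p.2) := fun p => by simp [iso]
  have hmp : MeasurePreserving (iso : ℝ × ℝ → ℝ × ℝ) := by
    have := measurePreserving_reflect
    convert this using 1
    ext1 p; exact hiso p
  have hemb : MeasurableEmbedding (iso : ℝ × ℝ → ℝ × ℝ) := iso.toHomeomorph.measurableEmbedding
  have hpre : (iso : ℝ × ℝ → ℝ × ℝ) ⁻¹' {p : ℝ × ℝ | 0 < p.1 ∧ μ * p.1 < p.2} =
      {p : ℝ × ℝ | 0 < p.1 ∧ p.2 < (-μ) * p.1} := by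
    ext ⟨t, y⟩
    simp only [mem_preimage, hiso, mem_setOf_eq, neg_mul]
    constructor <;> rintro ⟨h1, h2⟩ <;> exact ⟨h1, by linarith⟩
  rw [← hmp.setIntegral_preimage_emb hemb
    (fun p => q * fderiv ℝ Ψ p (1, 0) + f * fderiv ℝ Ψ p (0, 1)) {p | 0 < p.1 ∧ μ * p.1 < p.2}, hpre]
  have hΨ' : ContDiff ℝ 1 (Ψ ∘ iso) := hΨ.comp iso.contDiff
  have hΨ'c : HasCompactSupport (Ψ ∘ iso) := hΨc.comp_homeomorph iso.toHomeomorph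
  have hd1 : ∀ p : ℝ × ℝ, fderiv ℝ (Ψ ∘ iso) p (1, 0) = fderiv ℝ Ψ (iso p) (1, 0) := by
    intro p
    rw [iso.comp_right_fderiv, ContinuousLinearMap.comp_apply]
    have : ((iso : ℝ × ℝ →L[ℝ] ℝ × ℝ) (1, 0) : ℝ × ℝ) = (1, 0) := by
      rw [ContinuousLinearEquiv.coe_coe, hiso]; simp
    rw [this]
  have hd2 : ∀ p : ℝ × ℝ, fderiv ℝ (Ψ ∘ iso) p (0, 1) = -fderiv ℝ Ψ (iso p) (0, 1) := by
    intro p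
    rw [iso.comp_right_fderiv, ContinuousLinearMap.comp_apply]
    have : ((iso : ℝ × ℝ →L[ℝ] ℝ × ℝ) (0, 1) : ℝ × ℝ) = -((0 : ℝ), (1 : ℝ)) := by
      rw [ContinuousLinearEquiv.coe_coe, hiso]; simp
    rw [this, map_neg]
  have key : ∀ p : ℝ × ℝ, q * fderiv ℝ Ψ (iso p) (1, 0) + f * fderiv ℝ Ψ (iso p) (0, 1) =
      q * fderiv ℝ (Ψ ∘ iso) p (1, 0) + (-f) * fderiv ℝ (Ψ ∘ iso) p (0, 1) := by
    intro p; rw [hd1, hd2]; ring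
  simp_rw [key]
  rw [setIntegral_halfWedge hΨ' hΨ'c (-μ) q (-f)]
  simp only [Function.comp, hiso, neg_mul, neg_neg, mul_neg]
  -- `∫_{y<0} Ψ(0, -y) dy = ∫_{y>0} Ψ(0, y) dy`
  have hrefl : ∫ y in Iio (0 : ℝ), Ψ (0, -y) = ∫ y in Ioi (0 : ℝ), Ψ (0, y) := by
    have h := (Measure.measurePreserving_neg (volume : Measure ℝ)).setIntegral_preimage_emb
      (MeasurableEquiv.neg ℝ).measurableEmbedding (fun y => Ψ (0, y)) (Ioi (0 : ℝ))
    have hpre' : (Neg.neg : ℝ → ℝ) ⁻¹' Ioi (0 : ℝ) = Iio 0 := by ext y; simp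
    rw [hpre'] at h
    exact h
  rw [hrefl]; ring

/-- The lower half-wedge `{t > 0, y < μ t}` is measurable. [folklore] -/
theorem measurableSet_halfWedge (μ : ℝ) :
    MeasurableSet {p : ℝ × ℝ | 0 < p.1 ∧ p.2 < μ * p.1} :=
  (isOpen_lt continuous_const continuous_fst).inter
    (isOpen_lt continuous_snd (continuous_const.mul continuous_fst)) |>.measurableSet

/-- The upper half-wedge `{t > 0, y > μ t}` is measurable. [folklore] -/
theorem measurableSet_upperHalfWedge (μ : ℝ) :
    MeasurableSet {p : ℝ × ℝ | 0 < p.1 ∧ μ * p.1 < p.2} :=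
  (isOpen_lt continuous_const continuous_fst).inter
    (isOpen_lt (continuous_const.mul continuous_fst) continuous_snd) |>.measurableSet

/-- The middle wedge `{t > 0, μ t < y < ν t}` is measurable. [folklore] -/
theorem measurableSet_midWedge (μ ν : ℝ) :
    MeasurableSet {p : ℝ × ℝ | 0 < p.1 ∧ μ * p.1 < p.2 ∧ p.2 < ν * p.1} :=
  (isOpen_lt continuous_const continuous_fst).inter
    ((isOpen_lt (continuous_const.mul continuous_fst) continuous_snd).inter
    (isOpen_lt continuous_snd (continuous_const.mul continuous_fst))) |>.measurableSet

/-- The half-plane `{t > 0}` is measurable. [folklore] -/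
theorem measurableSet_halfPlane :
    MeasurableSet (Ioi (0 : ℝ) ×ˢ (univ : Set ℝ)) :=
  measurableSet_Ioi.prod MeasurableSet.univ

/-- Inclusion–exclusion for the middle wedge: `1_{mid} = 1_{H_ν} + 1_{U_μ} - 1_{t>0}` (exactly,
for `μ < ν`), at the level of integrals of an integrable function. [folklore] -/
theorem setIntegral_midWedge_eq {F : ℝ × ℝ → ℝ} (hF : Integrable F) {μ ν : ℝ} (hμν : μ < ν) :
    ∫ p in {p : ℝ × ℝ | 0 < p.1 ∧ μ * p.1 < p.2 ∧ p.2 < ν * p.1}, F p =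
      (∫ p in {p : ℝ × ℝ | 0 < p.1 ∧ p.2 < ν * p.1}, F p) +
        (∫ p in {p : ℝ × ℝ | 0 < p.1 ∧ μ * p.1 < p.2}, F p) -
        ∫ p in Ioi (0 : ℝ) ×ˢ (univ : Set ℝ), F p := by
  have h1 := hF.indicator (measurableSet_halfWedge ν)
  have h2 := hF.indicator (measurableSet_upperHalfWedge μ)
  have h3 := hF.indicator measurableSet_halfPlane
  have key : ∀ p : ℝ × ℝ,
      {p : ℝ × ℝ | 0 < p.1 ∧ μ * p.1 < p.2 ∧ p.2 < ν * p.1}.indicator F p =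
        {p : ℝ × ℝ | 0 < p.1 ∧ p.2 < ν * p.1}.indicator F p +
          {p : ℝ × ℝ | 0 < p.1 ∧ μ * p.1 < p.2}.indicator F p -
          (Ioi (0 : ℝ) ×ˢ (univ : Set ℝ)).indicator F p := by
    rintro ⟨t, y⟩
    simp only [indicator, mem_setOf_eq, mem_prod, mem_Ioi, mem_univ, and_true]
    by_cases ht : 0 < t
    · have hμν' : μ * t < ν * t := mul_lt_mul_of_pos_right hμν ht
      by_cases h1 : y < ν * t <;> by_cases h2 : μ * t < y <;> simp [ht, h1, h2]
      linarith
    · simp [ht]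
  calc ∫ p in {p : ℝ × ℝ | 0 < p.1 ∧ μ * p.1 < p.2 ∧ p.2 < ν * p.1}, F p
      = ∫ p, {p : ℝ × ℝ | 0 < p.1 ∧ μ * p.1 < p.2 ∧ p.2 < ν * p.1}.indicator F p :=
        (integral_indicator (measurableSet_midWedge μ ν)).symm
    _ = ∫ p, ({p : ℝ × ℝ | 0 < p.1 ∧ p.2 < ν * p.1}.indicator F p +
          {p : ℝ × ℝ | 0 < p.1 ∧ μ * p.1 < p.2}.indicator F p -
          (Ioi (0 : ℝ) ×ˢ (univ : Set ℝ)).indicator F p) :=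
        integral_congr_ae (Filter.Eventually.of_forall key)
    _ = (∫ p, ({p : ℝ × ℝ | 0 < p.1 ∧ p.2 < ν * p.1}.indicator F p +
          {p : ℝ × ℝ | 0 < p.1 ∧ μ * p.1 < p.2}.indicator F p)) -
          ∫ p, (Ioi (0 : ℝ) ×ˢ (univ : Set ℝ)).indicator F p := integral_sub (h1.add h2) h3
    _ = _ := by
        rw [integral_add h1 h2, integral_indicator (measurableSet_halfWedge ν),
          integral_indicator (measurableSet_upperHalfWedge μ),
          integral_indicator measurableSet_halfPlane]

/-- **Middle-wedge lemma.** For `Ψ ∈ C¹_c(ℝ²)`, `μ < ν` and `W = {t > 0, μ t < y < ν t}`: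
`∫_W (q ∂ₜΨ + f ∂_yΨ) = (f - q ν) ∫_{t>0} Ψ(t, ν t) dt - (f - q μ) ∫_{t>0} Ψ(t, μ t) dt`. [folklore] -/
theorem setIntegral_midWedge (hΨ : ContDiff ℝ 1 Ψ) (hΨc : HasCompactSupport Ψ) {μ ν : ℝ}
    (hμν : μ < ν) (q f : ℝ) :
    ∫ p in {p : ℝ × ℝ | 0 < p.1 ∧ μ * p.1 < p.2 ∧ p.2 < ν * p.1},
        (q * fderiv ℝ Ψ p (1, 0) + f * fderiv ℝ Ψ p (0, 1)) =
      (f - q * ν) * (∫ t in Ioi (0 : ℝ), Ψ (t, ν * t)) -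
        (f - q * μ) * ∫ t in Ioi (0 : ℝ), Ψ (t, μ * t) := by
  have hF : Integrable (fun p : ℝ × ℝ => q * fderiv ℝ Ψ p (1, 0) + f * fderiv ℝ Ψ p (0, 1)) :=
    ((integrable_fderiv_apply hΨ hΨc (1, 0)).const_mul q).add
      ((integrable_fderiv_apply hΨ hΨc (0, 1)).const_mul f)
  rw [setIntegral_midWedge_eq hF hμν, setIntegral_halfWedge hΨ hΨc, setIntegral_upperHalfWedge hΨ hΨc,
    setIntegral_halfPlane hΨ hΨc]
  -- split `∫ Ψ(0, y) dy` at `y = 0`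
  obtain ⟨R, -, hR⟩ := exists_radius hΨc
  have hg : Integrable (fun y : ℝ => Ψ (0, y)) := integrable_line_snd hΨ.continuous (fun p hp => (hR p hp).1) 0
  have hsplit : ∫ y, Ψ (0, y) = (∫ y in Iio (0 : ℝ), Ψ (0, y)) + ∫ y in Ioi (0 : ℝ), Ψ (0, y) := by
    rw [← setIntegral_univ, ← Iic_union_Ioi, setIntegral_union (Iic_disjoint_Ioi le_rfl)
      measurableSet_Ioi hg.integrableOn hg.integrableOn, integral_Iic_eq_integral_Iio]
  rw [hsplit]; ring


/-! ### Coordinates on `ℝ²` -/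

/-- The point of `ℝ²` with coordinates `(x, y)` is `single 0 x + single 1 y`; as a continuous
linear map of `(x, y)`. [folklore] -/
theorem mk_eq_clm (x y : ℝ) :
    (EuclideanSpace.single 0 x + EuclideanSpace.single 1 y : EuclideanSpace ℝ (Fin 2)) =
      ((ContinuousLinearMap.fst ℝ ℝ ℝ).smulRight (EuclideanSpace.single (0 : Fin 2) (1 : ℝ)) +
        (ContinuousLinearMap.snd ℝ ℝ ℝ).smulRight (EuclideanSpace.single (1 : Fin 2) (1 : ℝ)))
        (x, y) := by
  ext i
  fin_cases i <;> simp

/-- `(x, y) ↦ x e₀ + y e₁` is continuous. [folklore] -/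
theorem continuous_mk :
    Continuous fun p : ℝ × ℝ =>
      (EuclideanSpace.single 0 p.1 + EuclideanSpace.single 1 p.2 : EuclideanSpace ℝ (Fin 2)) := by
  have := ((ContinuousLinearMap.fst ℝ ℝ ℝ).smulRight (EuclideanSpace.single (0 : Fin 2) (1 : ℝ)) +
        (ContinuousLinearMap.snd ℝ ℝ ℝ).smulRight (EuclideanSpace.single (1 : Fin 2) (1 : ℝ))).continuous
  convert this using 1
  ext1 p; exact mk_eq_clm p.1 p.2

/-- First coordinate of `x e₀ + y e₁`. [folklore] -/
theorem mk_apply_zero (x y : ℝ) :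
    (EuclideanSpace.single 0 x + EuclideanSpace.single 1 y : EuclideanSpace ℝ (Fin 2)) 0 = x := by
  simp

/-- Second coordinate of `x e₀ + y e₁`. [folklore] -/
theorem mk_apply_one (x y : ℝ) :
    (EuclideanSpace.single 0 x + EuclideanSpace.single 1 y : EuclideanSpace ℝ (Fin 2)) 1 = y := by
  simp

/-- A coordinate is bounded by the Euclidean norm. [folklore] -/
theorem abs_apply_le_norm (v : EuclideanSpace ℝ (Fin 2)) (i : Fin 2) : |v i| ≤ ‖v‖ := by
  rw [EuclideanSpace.norm_eq]
  calc |v i| = Real.sqrt (‖v i‖ ^ 2) := by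
        rw [Real.sqrt_sq (norm_nonneg _), Real.norm_eq_abs]
    _ ≤ Real.sqrt (∑ j, ‖v j‖ ^ 2) :=
        Real.sqrt_le_sqrt (Finset.single_le_sum (f := fun j => ‖v j‖ ^ 2)
          (fun j _ => sq_nonneg _) (Finset.mem_univ i))

/-- The sup norm of `(x, y)` is bounded by the Euclidean norm of `x e₀ + y e₁`. [folklore] -/
theorem norm_mk_ge (x y : ℝ) :
    ‖((x, y) : ℝ × ℝ)‖ ≤
      ‖(EuclideanSpace.single 0 x + EuclideanSpace.single 1 y : EuclideanSpace ℝ (Fin 2))‖ := by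
  rw [Prod.norm_def]
  refine max_le ?_ ?_
  · have h := abs_apply_le_norm (EuclideanSpace.single 0 x + EuclideanSpace.single 1 y) 0
    rw [mk_apply_zero] at h
    simpa [Real.norm_eq_abs] using h
  · have h := abs_apply_le_norm (EuclideanSpace.single 0 x + EuclideanSpace.single 1 y) 1
    rw [mk_apply_one] at h
    simpa [Real.norm_eq_abs] using h

/-! ### Vanishing outside a ball -/

/-- A compactly supported function on a normed space and its derivative vanish outside a large
ball. [folklore] -/
theorem exists_radius' {E : Type*} [NormedAddCommGroup E] [NormedSpace ℝ E] {Ψ : E → ℝ}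
    (hΨc : HasCompactSupport Ψ) :
    ∃ R : ℝ, 0 < R ∧ ∀ p : E, R < ‖p‖ → Ψ p = 0 ∧ fderiv ℝ Ψ p = 0 := by
  obtain ⟨r, hr⟩ := hΨc.isCompact.isBounded.subset_closedBall (0 : E)
  refine ⟨max r 1, lt_max_of_lt_right one_pos, fun p hp => ?_⟩
  have hp' : p ∉ tsupport Ψ := by
    intro h
    have := hr h
    rw [Metric.mem_closedBall, dist_zero_right] at this
    exact absurd (lt_of_le_of_lt (le_max_left r 1) hp) (not_lt.mpr this)
  refine ⟨image_eq_zero_of_notMem_tsupport hp', ?_⟩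
  have : p ∉ tsupport (fderiv ℝ Ψ) := fun h => hp' (tsupport_fderiv_subset ℝ h)
  exact image_eq_zero_of_notMem_tsupport this

/-! ### Slices `Ψ_x(t, y) = φ(t, (x, y))` of a space–time test function -/

section slice

variable {φ : ℝ × EuclideanSpace ℝ (Fin 2) → ℝ}

/-- The slice map `(t, y) ↦ (t, (x, y))` is the continuous linear map
`L(t, y) = (t, y • e₁)` plus the constant `(0, x • e₀)`. [folklore] -/
theorem sliceMap_eq (x : ℝ) (p : ℝ × ℝ) :
    ((p.1, EuclideanSpace.single 0 x + EuclideanSpace.single 1 p.2) :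
        ℝ × EuclideanSpace ℝ (Fin 2)) =
      ((ContinuousLinearMap.fst ℝ ℝ ℝ).prod
          ((ContinuousLinearMap.snd ℝ ℝ ℝ).smulRight (EuclideanSpace.single (1 : Fin 2) (1 : ℝ)))) p +
        ((0 : ℝ), EuclideanSpace.single (0 : Fin 2) x) := by
  ext i
  · simp
  · fin_cases i <;> simp

/-- The slice map `(t, y) ↦ (t, (x, y))` has derivative `(t, y) ↦ (t, y e₁)`. [folklore] -/
theorem hasFDerivAt_sliceMap (x : ℝ) (p : ℝ × ℝ) :
    HasFDerivAt (fun p : ℝ × ℝ =>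
        ((p.1, EuclideanSpace.single 0 x + EuclideanSpace.single 1 p.2) :
          ℝ × EuclideanSpace ℝ (Fin 2)))
      ((ContinuousLinearMap.fst ℝ ℝ ℝ).prod
        ((ContinuousLinearMap.snd ℝ ℝ ℝ).smulRight (EuclideanSpace.single (1 : Fin 2) (1 : ℝ)))) p := by
  have h := (((ContinuousLinearMap.fst ℝ ℝ ℝ).prod
    ((ContinuousLinearMap.snd ℝ ℝ ℝ).smulRight
      (EuclideanSpace.single (1 : Fin 2) (1 : ℝ)))).hasFDerivAt (x := p)).add_const
      ((0 : ℝ), EuclideanSpace.single (0 : Fin 2) x)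
  have heq : (fun p : ℝ × ℝ =>
      ((p.1, EuclideanSpace.single 0 x + EuclideanSpace.single 1 p.2) :
        ℝ × EuclideanSpace ℝ (Fin 2))) = fun p =>
      ((ContinuousLinearMap.fst ℝ ℝ ℝ).prod
          ((ContinuousLinearMap.snd ℝ ℝ ℝ).smulRight (EuclideanSpace.single (1 : Fin 2) (1 : ℝ)))) p +
        ((0 : ℝ), EuclideanSpace.single (0 : Fin 2) x) := funext (sliceMap_eq x)
  rw [heq]; exact h

/-- Slices of a `Cⁿ` space–time function are `Cⁿ`. [folklore] -/
theorem contDiff_slice {n : WithTop ℕ∞} (hφ : ContDiff ℝ n φ) (x : ℝ) :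
    ContDiff ℝ n fun p : ℝ × ℝ =>
      φ (p.1, EuclideanSpace.single 0 x + EuclideanSpace.single 1 p.2) := by
  have hA : ContDiff ℝ n fun p : ℝ × ℝ =>
      ((p.1, EuclideanSpace.single 0 x + EuclideanSpace.single 1 p.2) :
        ℝ × EuclideanSpace ℝ (Fin 2)) := by
    have := (((ContinuousLinearMap.fst ℝ ℝ ℝ).prod
      ((ContinuousLinearMap.snd ℝ ℝ ℝ).smulRight
        (EuclideanSpace.single (1 : Fin 2) (1 : ℝ)))).contDiff (n := n)).add
        (contDiff_const (c := ((0 : ℝ), EuclideanSpace.single (0 : Fin 2) x)))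
    convert this using 1
    ext1 p; exact sliceMap_eq x p
  exact hφ.comp hA

/-- Slices of a compactly supported space–time function are compactly supported. [folklore] -/
theorem hasCompactSupport_slice (hφc : HasCompactSupport φ) (x : ℝ) :
    HasCompactSupport fun p : ℝ × ℝ =>
      φ (p.1, EuclideanSpace.single 0 x + EuclideanSpace.single 1 p.2) := by
  refine HasCompactSupport.intro
    (hφc.image (show Continuous fun z : ℝ × EuclideanSpace ℝ (Fin 2) => (z.1, z.2 1) by fun_prop))
    (fun p hp => ?_)
  by_contra h
  apply hp
  refine ⟨(p.1, EuclideanSpace.single 0 x + EuclideanSpace.single 1 p.2), subset_tsupport _ h, ?_⟩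
  simp

/-- Chain rule for the slice `Ψ_x(t, y) = φ(t, (x, y))`. [folklore] -/
theorem fderiv_slice (hφ : ContDiff ℝ 1 φ) (x : ℝ) (p v : ℝ × ℝ) :
    fderiv ℝ (fun p : ℝ × ℝ =>
        φ (p.1, EuclideanSpace.single 0 x + EuclideanSpace.single 1 p.2)) p v =
      fderiv ℝ φ (p.1, EuclideanSpace.single 0 x + EuclideanSpace.single 1 p.2)
        (v.1, EuclideanSpace.single 1 v.2) := by
  have hd : HasFDerivAt φ (fderiv ℝ φ (p.1, EuclideanSpace.single 0 x + EuclideanSpace.single 1 p.2))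
      (p.1, EuclideanSpace.single 0 x + EuclideanSpace.single 1 p.2) :=
    ((hφ.differentiable one_ne_zero) _).hasFDerivAt
  have hc := hd.comp p (hasFDerivAt_sliceMap x p)
  rw [show (fun p : ℝ × ℝ => φ (p.1, EuclideanSpace.single 0 x + EuclideanSpace.single 1 p.2)) =
    φ ∘ (fun p : ℝ × ℝ => ((p.1, EuclideanSpace.single 0 x + EuclideanSpace.single 1 p.2) :
      ℝ × EuclideanSpace ℝ (Fin 2))) from rfl, hc.fderiv, ContinuousLinearMap.comp_apply]
  congr 1
  ext i
  · simp
  · fin_cases i <;> simp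

/-- `∂ₜΨ_x = (∂ₜφ) ∘ slice`. [folklore] -/
theorem fderiv_slice_fst (hφ : ContDiff ℝ 1 φ) (x : ℝ) (p : ℝ × ℝ) :
    fderiv ℝ (fun p : ℝ × ℝ =>
        φ (p.1, EuclideanSpace.single 0 x + EuclideanSpace.single 1 p.2)) p (1, 0) =
      fderiv ℝ φ (p.1, EuclideanSpace.single 0 x + EuclideanSpace.single 1 p.2) (1, 0) := by
  rw [fderiv_slice hφ]
  have h0 : EuclideanSpace.single (1 : Fin 2) (0 : ℝ) = 0 := (PiLp.single_eq_zero_iff _ _).mpr rfl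
  simp [h0]

/-- `∂_yΨ_x = (∂_yφ) ∘ slice`. [folklore] -/
theorem fderiv_slice_snd (hφ : ContDiff ℝ 1 φ) (x : ℝ) (p : ℝ × ℝ) :
    fderiv ℝ (fun p : ℝ × ℝ =>
        φ (p.1, EuclideanSpace.single 0 x + EuclideanSpace.single 1 p.2)) p (0, 1) =
      fderiv ℝ φ (p.1, EuclideanSpace.single 0 x + EuclideanSpace.single 1 p.2)
        (0, EuclideanSpace.single 1 1) := by
  rw [fderiv_slice hφ]

end slice


/-! ### Fan coordinates `(t, v) ↦ (v 0, (t, v 1))` on `ℝ × ℝ²` -/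

/-- The coordinate map `(t, v) ↦ (v 0, (t, v 1))` and its inverse
`(x, (t, y)) ↦ (t, x e₀ + y e₁)` are measure-preserving measurable embeddings. [folklore] -/
theorem fanCoord_spec :
    (MeasurePreserving (fun z : ℝ × EuclideanSpace ℝ (Fin 2) => ((z.2 0, (z.1, z.2 1)) : ℝ × (ℝ × ℝ)))
      ∧ MeasurableEmbedding
        (fun z : ℝ × EuclideanSpace ℝ (Fin 2) => ((z.2 0, (z.1, z.2 1)) : ℝ × (ℝ × ℝ)))) ∧
    (MeasurePreserving (fun q : ℝ × (ℝ × ℝ) =>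
        ((q.2.1, EuclideanSpace.single 0 q.1 + EuclideanSpace.single 1 q.2.2) :
          ℝ × EuclideanSpace ℝ (Fin 2)))
      ∧ MeasurableEmbedding (fun q : ℝ × (ℝ × ℝ) =>
        ((q.2.1, EuclideanSpace.single 0 q.1 + EuclideanSpace.single 1 q.2.2) :
          ℝ × EuclideanSpace ℝ (Fin 2)))) := by
  let e2 : EuclideanSpace ℝ (Fin 2) ≃ᵐ ℝ × ℝ :=
    (MeasurableEquiv.toLp 2 (Fin 2 → ℝ)).symm.trans MeasurableEquiv.finTwoArrow
  let Θ : (ℝ × EuclideanSpace ℝ (Fin 2)) ≃ᵐ ℝ × (ℝ × ℝ) := (MeasurableEquiv.refl ℝ).prodCongr e2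
  let Ξ : (ℝ × (ℝ × ℝ)) ≃ᵐ ℝ × (ℝ × ℝ) :=
    (MeasurableEquiv.prodAssoc.symm.trans
      (MeasurableEquiv.prodComm.prodCongr (MeasurableEquiv.refl ℝ))).trans MeasurableEquiv.prodAssoc
  let Φ : (ℝ × EuclideanSpace ℝ (Fin 2)) ≃ᵐ ℝ × (ℝ × ℝ) := Θ.trans Ξ
  have hΦ : ∀ z : ℝ × EuclideanSpace ℝ (Fin 2), Φ z = (z.2 0, (z.1, z.2 1)) := fun z => by
    simp [Φ, Θ, Ξ, e2, MeasurableEquiv.finTwoArrow, MeasurableEquiv.prodAssoc,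
      MeasurableEquiv.prodCongr, MeasurableEquiv.prodComm]
  have hΦ' : (Φ : ℝ × EuclideanSpace ℝ (Fin 2) → ℝ × (ℝ × ℝ)) =
      fun z => (z.2 0, (z.1, z.2 1)) := funext hΦ
  have hΦsymm : ∀ q : ℝ × (ℝ × ℝ), Φ.symm q =
      (q.2.1, EuclideanSpace.single 0 q.1 + EuclideanSpace.single 1 q.2.2) := by
    intro q
    apply Φ.injective
    rw [MeasurableEquiv.apply_symm_apply, hΦ]
    simp
  have hΦsymm' : (Φ.symm : ℝ × (ℝ × ℝ) → ℝ × EuclideanSpace ℝ (Fin 2)) =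
      fun q => (q.2.1, EuclideanSpace.single 0 q.1 + EuclideanSpace.single 1 q.2.2) :=
    funext hΦsymm
  have he2 : MeasurePreserving e2 volume volume :=
    (EuclideanSpace.volume_preserving_symm_measurableEquiv_toLp (Fin 2)).trans
      (volume_preserving_finTwoArrow ℝ)
  have hΘ : MeasurePreserving Θ volume volume :=
    (MeasurePreserving.id (volume : Measure ℝ)).prod he2
  have hΞ : MeasurePreserving Ξ volume volume :=
    (((measurePreserving_prodAssoc (volume : Measure ℝ) (volume : Measure ℝ)
      (volume : Measure ℝ)).symm _).trans
      ((Measure.measurePreserving_swap (μ := (volume : Measure ℝ))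
        (ν := (volume : Measure ℝ))).prod (MeasurePreserving.id (volume : Measure ℝ)))).trans
      (measurePreserving_prodAssoc (volume : Measure ℝ) (volume : Measure ℝ) (volume : Measure ℝ))
  have hmp : MeasurePreserving Φ volume volume := hΘ.trans hΞ
  refine ⟨⟨?_, ?_⟩, ?_, ?_⟩
  · rw [← hΦ']; exact hmp
  · rw [← hΦ']; exact Φ.measurableEmbedding
  · rw [← hΦsymm']; exact hmp.symm Φ
  · rw [← hΦsymm']; exact Φ.symm.measurableEmbedding

/-- Transport of a fan-region integral on `ℝ × ℝ²` to an iterated integral: `x` outside, the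
`(t, y)`-region inside. [folklore] -/
theorem integral_fanRegion (W : Set (ℝ × ℝ)) {F : ℝ × EuclideanSpace ℝ (Fin 2) → ℝ}
    (hF : Integrable F) :
    ∫ z in {z : ℝ × EuclideanSpace ℝ (Fin 2) | (z.1, z.2 1) ∈ W}, F z =
      ∫ x : ℝ, ∫ w in W, F (w.1, EuclideanSpace.single 0 x + EuclideanSpace.single 1 w.2) := by
  obtain ⟨⟨hS, hSe⟩, hU, -⟩ := fanCoord_spec
  have hset : {z : ℝ × EuclideanSpace ℝ (Fin 2) | (z.1, z.2 1) ∈ W} =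
      (fun z : ℝ × EuclideanSpace ℝ (Fin 2) => ((z.2 0, (z.1, z.2 1)) : ℝ × (ℝ × ℝ))) ⁻¹'
        ((univ : Set ℝ) ×ˢ W) := by
    ext z; simp
  have hUS : ∀ z : ℝ × EuclideanSpace ℝ (Fin 2),
      ((z.1, EuclideanSpace.single 0 (z.2 0) + EuclideanSpace.single 1 (z.2 1)) :
        ℝ × EuclideanSpace ℝ (Fin 2)) = z := by
    rintro ⟨t, v⟩
    ext i
    · rfl
    · fin_cases i <;> simp
  have hFi : Integrable (fun q : ℝ × (ℝ × ℝ) =>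
      F (q.2.1, EuclideanSpace.single 0 q.1 + EuclideanSpace.single 1 q.2.2))
      ((volume : Measure ℝ).prod (volume : Measure (ℝ × ℝ))) :=
    (hU.integrable_comp hF.aestronglyMeasurable).mpr hF
  calc ∫ z in {z : ℝ × EuclideanSpace ℝ (Fin 2) | (z.1, z.2 1) ∈ W}, F z
      = ∫ z in (fun z : ℝ × EuclideanSpace ℝ (Fin 2) => ((z.2 0, (z.1, z.2 1)) : ℝ × (ℝ × ℝ))) ⁻¹'
          ((univ : Set ℝ) ×ˢ W), (fun q : ℝ × (ℝ × ℝ) =>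
            F (q.2.1, EuclideanSpace.single 0 q.1 + EuclideanSpace.single 1 q.2.2))
            ((z.2 0, (z.1, z.2 1)) : ℝ × (ℝ × ℝ)) := by
        simp only [hset, hUS]
    _ = ∫ q in (univ : Set ℝ) ×ˢ W,
          F (q.2.1, EuclideanSpace.single 0 q.1 + EuclideanSpace.single 1 q.2.2) :=
        hS.setIntegral_preimage_emb hSe (fun q : ℝ × (ℝ × ℝ) =>
            F (q.2.1, EuclideanSpace.single 0 q.1 + EuclideanSpace.single 1 q.2.2))
          ((univ : Set ℝ) ×ˢ W)
    _ = ∫ x in (univ : Set ℝ), ∫ w in W,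
          F (w.1, EuclideanSpace.single 0 x + EuclideanSpace.single 1 w.2) := by
        rw [Measure.volume_eq_prod, setIntegral_prod _ hFi.integrableOn]
    _ = _ := by rw [Measure.restrict_univ]

/-- Integrability of the `x`-line restriction `x ↦ F(t, (x, y))` of a continuous function
vanishing outside a ball. [folklore] -/
theorem integrable_xline {F : ℝ × EuclideanSpace ℝ (Fin 2) → ℝ} (hF : Continuous F) {R : ℝ}
    (hR : ∀ z : ℝ × EuclideanSpace ℝ (Fin 2), R < ‖z‖ → F z = 0) (t y : ℝ) :
    Integrable (fun x : ℝ => F (t, EuclideanSpace.single 0 x + EuclideanSpace.single 1 y)) := by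
  refine Continuous.integrable_of_hasCompactSupport
    (hF.comp (Continuous.prodMk continuous_const
      (continuous_mk.comp (continuous_id.prodMk continuous_const)))) ?_
  refine HasCompactSupport.intro (isCompact_Icc : IsCompact (Icc (-R) R)) (fun x hx => hR _ ?_)
  have h1 : R < ‖((x, y) : ℝ × ℝ)‖ := by
    refine lt_of_lt_of_le ?_ (norm_fst_le (x, y))
    simp only [mem_Icc, not_and_or, not_le] at hx
    rw [Real.norm_eq_abs]
    rcases hx with h | h
    · linarith [neg_abs_le x]
    · linarith [le_abs_self x]
  refine lt_of_lt_of_le (lt_of_lt_of_le h1 (norm_mk_ge x y)) ?_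
  rw [Prod.norm_def]; exact le_max_right _ _

/-- The `x`-derivative of a `C¹_c` function integrates to zero over any fan region. [folklore] -/
theorem integral_fanRegion_dx_eq_zero (W : Set (ℝ × ℝ))
    {φ : ℝ × EuclideanSpace ℝ (Fin 2) → ℝ} (hφ : ContDiff ℝ 1 φ) (hφc : HasCompactSupport φ) :
    ∫ z in {z : ℝ × EuclideanSpace ℝ (Fin 2) | (z.1, z.2 1) ∈ W},
      fderiv ℝ φ z (0, EuclideanSpace.single 0 1) = 0 := by
  obtain ⟨-, hU, -⟩ := fanCoord_spec
  have hcont : Continuous fun z => fderiv ℝ φ z (0, EuclideanSpace.single 0 1) :=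
    (hφ.continuous_fderiv one_ne_zero).clm_apply continuous_const
  have hF : Integrable (fun z => fderiv ℝ φ z (0, EuclideanSpace.single 0 1)) :=
    hcont.integrable_of_hasCompactSupport (hφc.fderiv_apply ℝ _)
  rw [integral_fanRegion W hF]
  have hFi : Integrable (fun q : ℝ × (ℝ × ℝ) =>
      fderiv ℝ φ (q.2.1, EuclideanSpace.single 0 q.1 + EuclideanSpace.single 1 q.2.2)
        (0, EuclideanSpace.single 0 1))
      ((volume : Measure ℝ).prod ((volume : Measure (ℝ × ℝ)).restrict W)) := by
    have h := (hU.integrable_comp hF.aestronglyMeasurable).mpr hF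
    rw [← Measure.restrict_univ (μ := (volume : Measure ℝ)), Measure.prod_restrict,
      ← Measure.volume_eq_prod]
    exact h.restrict
  rw [integral_integral_swap hFi]
  refine integral_eq_zero_of_ae (Filter.Eventually.of_forall fun w => ?_)
  obtain ⟨R, -, hR⟩ := exists_radius' hφc
  simp only
  refine integral_eq_zero_of_hasDerivAt_of_integrable
    (f := fun x => φ (w.1, EuclideanSpace.single 0 x + EuclideanSpace.single 1 w.2))
    (fun x => ?_) (integrable_xline hcont (fun z hz => by rw [(hR z hz).2]; rfl) w.1 w.2)
    (integrable_xline hφ.continuous (fun z hz => (hR z hz).1) w.1 w.2)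
  -- derivative along the `x`-line
  have hc : HasDerivAt (fun x : ℝ =>
      ((w.1, EuclideanSpace.single 0 x + EuclideanSpace.single 1 w.2) :
        ℝ × EuclideanSpace ℝ (Fin 2)))
      ((0 : ℝ), EuclideanSpace.single (0 : Fin 2) (1 : ℝ)) x := by
    have h := ((hasDerivAt_id' x).smul_const
      (((0 : ℝ), EuclideanSpace.single (0 : Fin 2) (1 : ℝ)) :
        ℝ × EuclideanSpace ℝ (Fin 2))).const_add
      ((w.1, EuclideanSpace.single (1 : Fin 2) w.2) : ℝ × EuclideanSpace ℝ (Fin 2))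
    rw [one_smul] at h
    have heq : (fun x : ℝ =>
        ((w.1, EuclideanSpace.single 0 x + EuclideanSpace.single 1 w.2) :
          ℝ × EuclideanSpace ℝ (Fin 2))) = fun x : ℝ =>
        ((w.1, EuclideanSpace.single (1 : Fin 2) w.2) : ℝ × EuclideanSpace ℝ (Fin 2)) +
          x • (((0 : ℝ), EuclideanSpace.single (0 : Fin 2) (1 : ℝ)) :
            ℝ × EuclideanSpace ℝ (Fin 2)) := by
      funext x
      refine Prod.ext (by simp) ?_
      ext i
      fin_cases i <;> simp
    rw [heq]; exact h
  exact (((hφ.differentiable one_ne_zero) _).hasFDerivAt.comp_hasDerivAt x hc)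

/-! ### Integrability in `x` of the boundary functionals -/

section boundary

variable {φ : ℝ × EuclideanSpace ℝ (Fin 2) → ℝ}

/-- A compactly supported function vanishes outside a large ball. [folklore] -/
theorem exists_radius_zero {E : Type*} [NormedAddCommGroup E] {Ψ : E → ℝ}
    (hΨc : HasCompactSupport Ψ) : ∃ R : ℝ, 0 < R ∧ ∀ p : E, R < ‖p‖ → Ψ p = 0 := by
  obtain ⟨r, hr⟩ := hΨc.isCompact.isBounded.subset_closedBall (0 : E)
  refine ⟨max r 1, lt_max_of_lt_right one_pos, fun p hp => ?_⟩
  have hp' : p ∉ tsupport Ψ := by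
    intro h
    have := hr h
    rw [Metric.mem_closedBall, dist_zero_right] at this
    exact absurd (lt_of_le_of_lt (le_max_left r 1) hp) (not_lt.mpr this)
  exact image_eq_zero_of_notMem_tsupport hp'

/-- `(x, y) ↦ φ(t, (x, y))` is integrable on `ℝ²`. [folklore] -/
theorem integrable_timeSlice (hφ : Continuous φ) (hφc : HasCompactSupport φ) (t : ℝ) :
    Integrable (fun p : ℝ × ℝ =>
      φ (t, EuclideanSpace.single 0 p.1 + EuclideanSpace.single 1 p.2)) := by
  obtain ⟨R, -, hR⟩ := exists_radius_zero hφc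
  refine Continuous.integrable_of_hasCompactSupport
    (hφ.comp (continuous_const.prodMk continuous_mk)) ?_
  refine HasCompactSupport.intro (isCompact_closedBall (0 : ℝ × ℝ) R) (fun p hp => hR _ ?_)
  rw [Metric.mem_closedBall, dist_zero_right, not_le] at hp
  have h1 : R < ‖(EuclideanSpace.single 0 p.1 + EuclideanSpace.single 1 p.2 :
      EuclideanSpace ℝ (Fin 2))‖ := lt_of_lt_of_le hp (norm_mk_ge p.1 p.2)
  refine lt_of_lt_of_le h1 ?_
  rw [Prod.norm_def]; exact le_max_right _ _

/-- `(x, t) ↦ φ(t, (x, μ t))` is integrable on `ℝ²`. [folklore] -/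
theorem integrable_raySlice (hφ : Continuous φ) (hφc : HasCompactSupport φ) (μ : ℝ) :
    Integrable (fun p : ℝ × ℝ =>
      φ (p.2, EuclideanSpace.single 0 p.1 + EuclideanSpace.single 1 (μ * p.2))) := by
  obtain ⟨R, -, hR⟩ := exists_radius_zero hφc
  refine Continuous.integrable_of_hasCompactSupport
    (hφ.comp (continuous_snd.prodMk
      (continuous_mk.comp (continuous_fst.prodMk (continuous_const.mul continuous_snd))))) ?_
  refine HasCompactSupport.intro (isCompact_closedBall (0 : ℝ × ℝ) R) (fun p hp => hR _ ?_)
  rw [Metric.mem_closedBall, dist_zero_right, not_le, Prod.norm_def, lt_max_iff] at hp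
  rw [Prod.norm_def]
  rcases hp with h | h
  · refine lt_of_lt_of_le ?_ (le_max_right _ _)
    refine lt_of_lt_of_le ?_ (norm_mk_ge p.1 (μ * p.2))
    exact lt_of_lt_of_le h (norm_fst_le (p.1, μ * p.2))
  · exact lt_of_lt_of_le h (le_max_left _ _)

/-- `x ↦ ∫_{y ∈ s} φ(t, (x, y)) dy` is integrable. [folklore] -/
theorem integrable_timeSlice_integral (hφ : Continuous φ) (hφc : HasCompactSupport φ) (t : ℝ)
    {s : Set ℝ} (hs : MeasurableSet s) :
    Integrable (fun x : ℝ =>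
      ∫ y in s, φ (t, EuclideanSpace.single 0 x + EuclideanSpace.single 1 y)) := by
  have h := ((integrable_timeSlice hφ hφc t).indicator
    (measurable_snd hs : MeasurableSet {p : ℝ × ℝ | p.2 ∈ s})).integral_prod_left
  refine h.congr (Filter.Eventually.of_forall fun x => ?_)
  simp only
  rw [← integral_indicator hs]
  congr 1

/-- `x ↦ ∫_{t>0} φ(t, (x, μ t)) dt` is integrable. [folklore] -/
theorem integrable_raySlice_integral (hφ : Continuous φ) (hφc : HasCompactSupport φ) (μ : ℝ) :
    Integrable (fun x : ℝ =>
      ∫ t in Ioi (0 : ℝ), φ (t, EuclideanSpace.single 0 x + EuclideanSpace.single 1 (μ * t))) := by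
  have h := ((integrable_raySlice hφ hφc μ).indicator
    (measurable_snd measurableSet_Ioi : MeasurableSet {p : ℝ × ℝ | p.2 ∈ Ioi (0 : ℝ)})).integral_prod_left
  refine h.congr (Filter.Eventually.of_forall fun x => ?_)
  simp only
  rw [← integral_indicator measurableSet_Ioi]
  congr 1

/-- The coordinate map `(x, y) ↦ x e₀ + y e₁ : ℝ² → ℝ²` is a measure-preserving measurable
embedding. [folklore] -/
theorem measurePreserving_mk :
    MeasurePreserving (fun p : ℝ × ℝ =>
      (EuclideanSpace.single 0 p.1 + EuclideanSpace.single 1 p.2 : EuclideanSpace ℝ (Fin 2))) ∧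
    MeasurableEmbedding (fun p : ℝ × ℝ =>
      (EuclideanSpace.single 0 p.1 + EuclideanSpace.single 1 p.2 : EuclideanSpace ℝ (Fin 2))) := by
  let e2 : EuclideanSpace ℝ (Fin 2) ≃ᵐ ℝ × ℝ :=
    (MeasurableEquiv.toLp 2 (Fin 2 → ℝ)).symm.trans MeasurableEquiv.finTwoArrow
  have he2 : MeasurePreserving e2 volume volume :=
    (EuclideanSpace.volume_preserving_symm_measurableEquiv_toLp (Fin 2)).trans
      (volume_preserving_finTwoArrow ℝ)
  have hsymm : (e2.symm : ℝ × ℝ → EuclideanSpace ℝ (Fin 2)) = fun p =>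
      (EuclideanSpace.single 0 p.1 + EuclideanSpace.single 1 p.2 : EuclideanSpace ℝ (Fin 2)) := by
    funext p
    ext i
    fin_cases i <;> simp [e2, MeasurableEquiv.finTwoArrow]
  rw [← hsymm]
  exact ⟨he2.symm e2, e2.symm.measurableEmbedding⟩

/-- The initial-data pairing of a datum that is piecewise constant across `{y = 0}`:
`∫_{ℝ²} q_init(v) φ(0, v) dv = q₋ ∫∫_{y<0} φ(0, (x, y)) + q₊ ∫∫_{y>0} φ(0, (x, y))`. [folklore] -/
theorem integral_initial (hφ : Continuous φ) (hφc : HasCompactSupport φ) (a b : ℝ) :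
    ∫ v : EuclideanSpace ℝ (Fin 2), (if v 1 < 0 then a else b) * φ (0, v) =
      a * (∫ x : ℝ, ∫ y in Iio (0 : ℝ),
          φ (0, EuclideanSpace.single 0 x + EuclideanSpace.single 1 y)) +
        b * ∫ x : ℝ, ∫ y in Ioi (0 : ℝ),
          φ (0, EuclideanSpace.single 0 x + EuclideanSpace.single 1 y) := by
  obtain ⟨hmp, hemb⟩ := measurePreserving_mk
  rw [← hmp.integral_comp hemb]
  simp only [mk_apply_one]
  have hG := integrable_timeSlice hφ hφc 0
  have hI : Integrable (fun p : ℝ × ℝ => (if p.2 < 0 then a else b) *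
      φ (0, EuclideanSpace.single 0 p.1 + EuclideanSpace.single 1 p.2)) := by
    refine hG.bdd_mul (c := max |a| |b|) ?_ (Filter.Eventually.of_forall fun p => ?_)
    · exact (Measurable.ite (measurableSet_lt measurable_snd measurable_const) measurable_const
        measurable_const).aestronglyMeasurable
    · simp only [Real.norm_eq_abs]
      split_ifs
      · exact le_max_left _ _
      · exact le_max_right _ _
  rw [Measure.volume_eq_prod, integral_prod _ (by rwa [Measure.volume_eq_prod] at hI)]
  have hinner : ∀ x : ℝ, ∫ y : ℝ, (if y < 0 then a else b) *
      φ (0, EuclideanSpace.single 0 x + EuclideanSpace.single 1 y) =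
      a * (∫ y in Iio (0 : ℝ), φ (0, EuclideanSpace.single 0 x + EuclideanSpace.single 1 y)) +
        b * ∫ y in Ioi (0 : ℝ), φ (0, EuclideanSpace.single 0 x + EuclideanSpace.single 1 y) := by
    intro x
    obtain ⟨R, -, hR⟩ := exists_radius_zero hφc
    have hline : Integrable (fun y : ℝ => (if y < 0 then a else b) *
        φ (0, EuclideanSpace.single 0 x + EuclideanSpace.single 1 y)) := by
      have hl : Integrable (fun y : ℝ =>
          φ (0, EuclideanSpace.single 0 x + EuclideanSpace.single 1 y)) := by
        have := integrable_line_snd (F := fun p : ℝ × ℝ =>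
          φ (0, EuclideanSpace.single 0 p.1 + EuclideanSpace.single 1 p.2))
          (hφ.comp (continuous_const.prodMk continuous_mk)) (R := R) (fun p hp => hR _ ?_) x
        · exact this
        · refine lt_of_lt_of_le (lt_of_lt_of_le hp (norm_mk_ge p.1 p.2)) ?_
          rw [Prod.norm_def]; exact le_max_right _ _
      refine hl.bdd_mul (c := max |a| |b|) ?_ (Filter.Eventually.of_forall fun y => ?_)
      · exact (Measurable.ite (measurableSet_lt measurable_id measurable_const) measurable_const
          measurable_const).aestronglyMeasurable
      · simp only [Real.norm_eq_abs]
        split_ifs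
        · exact le_max_left _ _
        · exact le_max_right _ _
    rw [← setIntegral_univ, ← Iio_union_Ici, setIntegral_union (Iio_disjoint_Ici le_rfl)
      measurableSet_Ici hline.integrableOn hline.integrableOn, integral_Ici_eq_integral_Ioi,
      ← integral_const_mul, ← integral_const_mul]
    congr 1
    · refine setIntegral_congr_fun measurableSet_Iio (fun y hy => ?_)
      simp [mem_Iio.mp hy]
    · refine setIntegral_congr_fun measurableSet_Ioi (fun y hy => ?_)
      simp [not_lt.mpr (le_of_lt (mem_Ioi.mp hy))]
  simp_rw [hinner]
  rw [integral_add ((integrable_timeSlice_integral hφ hφc 0 measurableSet_Iio).const_mul a)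
    ((integrable_timeSlice_integral hφ hφc 0 measurableSet_Ioi).const_mul b),
    integral_const_mul, integral_const_mul]

end boundary

/-! ### Weak divergence of a constant field on a fan region -/

section region

variable {φ : ℝ × EuclideanSpace ℝ (Fin 2) → ℝ}

/-- Directional derivatives of a `C¹_c` space–time function are integrable. [folklore] -/
theorem integrable_fderiv_apply' (hφ : ContDiff ℝ 1 φ) (hφc : HasCompactSupport φ)
    (v : ℝ × EuclideanSpace ℝ (Fin 2)) : Integrable (fun z => fderiv ℝ φ z v) :=
  ((hφ.continuous_fderiv one_ne_zero).clm_apply continuous_const).integrable_of_hasCompactSupport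
    (hφc.fderiv_apply ℝ v)

/-- **Generic fan-region lemma.** The pairing of the constant space–time field `(q, g, f)` with
the gradient of a test function over the fan region `{(t, v) | (t, v 1) ∈ W}` is computed from
the two-dimensional boundary functional of `W` (hypothesis `h2D`, slice by slice in `x`). [folklore] -/
theorem integral_fanRegion_of_2D (W : Set (ℝ × ℝ)) (hφ : ContDiff ℝ 1 φ)
    (hφc : HasCompactSupport φ) (q g f c₁ c₂ c₃ c₄ μ ν : ℝ)
    (h2D : ∀ Ψ : ℝ × ℝ → ℝ, ContDiff ℝ 1 Ψ → HasCompactSupport Ψ →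
      ∫ p in W, (q * fderiv ℝ Ψ p (1, 0) + f * fderiv ℝ Ψ p (0, 1)) =
        c₁ * (∫ y in Iio (0 : ℝ), Ψ (0, y)) + c₂ * (∫ y in Ioi (0 : ℝ), Ψ (0, y)) +
          c₃ * (∫ t in Ioi (0 : ℝ), Ψ (t, μ * t)) + c₄ * ∫ t in Ioi (0 : ℝ), Ψ (t, ν * t)) :
    ∫ z in {z : ℝ × EuclideanSpace ℝ (Fin 2) | (z.1, z.2 1) ∈ W},
        (q * fderiv ℝ φ z (1, 0) + g * fderiv ℝ φ z (0, EuclideanSpace.single 0 1) +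
          f * fderiv ℝ φ z (0, EuclideanSpace.single 1 1)) =
      c₁ * (∫ x : ℝ, ∫ y in Iio (0 : ℝ),
          φ (0, EuclideanSpace.single 0 x + EuclideanSpace.single 1 y)) +
        c₂ * (∫ x : ℝ, ∫ y in Ioi (0 : ℝ),
          φ (0, EuclideanSpace.single 0 x + EuclideanSpace.single 1 y)) +
        c₃ * (∫ x : ℝ, ∫ t in Ioi (0 : ℝ),
          φ (t, EuclideanSpace.single 0 x + EuclideanSpace.single 1 (μ * t))) +
        c₄ * ∫ x : ℝ, ∫ t in Ioi (0 : ℝ),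
          φ (t, EuclideanSpace.single 0 x + EuclideanSpace.single 1 (ν * t)) := by
  have hT := integrable_fderiv_apply' hφ hφc (1, 0)
  have hX := integrable_fderiv_apply' hφ hφc (0, EuclideanSpace.single 0 1)
  have hY := integrable_fderiv_apply' hφ hφc (0, EuclideanSpace.single 1 1)
  have hQ : Integrable (fun z : ℝ × EuclideanSpace ℝ (Fin 2) =>
      q * fderiv ℝ φ z (1, 0) + f * fderiv ℝ φ z (0, EuclideanSpace.single 1 1)) :=
    (hT.const_mul q).add (hY.const_mul f)
  have hXg : Integrable (fun z : ℝ × EuclideanSpace ℝ (Fin 2) =>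
      g * fderiv ℝ φ z (0, EuclideanSpace.single 0 1)) := hX.const_mul g
  have hsplit : ∫ z in {z : ℝ × EuclideanSpace ℝ (Fin 2) | (z.1, z.2 1) ∈ W},
        (q * fderiv ℝ φ z (1, 0) + g * fderiv ℝ φ z (0, EuclideanSpace.single 0 1) +
          f * fderiv ℝ φ z (0, EuclideanSpace.single 1 1)) =
      (∫ z in {z : ℝ × EuclideanSpace ℝ (Fin 2) | (z.1, z.2 1) ∈ W},
        (q * fderiv ℝ φ z (1, 0) + f * fderiv ℝ φ z (0, EuclideanSpace.single 1 1))) +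
      g * ∫ z in {z : ℝ × EuclideanSpace ℝ (Fin 2) | (z.1, z.2 1) ∈ W},
        fderiv ℝ φ z (0, EuclideanSpace.single 0 1) := by
    rw [← integral_const_mul, ← integral_add hQ.integrableOn hXg.integrableOn]
    refine integral_congr_ae (Filter.Eventually.of_forall fun z => ?_)
    simp only; ring
  rw [hsplit, integral_fanRegion_dx_eq_zero W hφ hφc, mul_zero, add_zero,
    integral_fanRegion W hQ]
  have hx : ∀ x : ℝ, ∫ w in W, (q * fderiv ℝ φ
        (w.1, EuclideanSpace.single 0 x + EuclideanSpace.single 1 w.2) (1, 0) +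
        f * fderiv ℝ φ (w.1, EuclideanSpace.single 0 x + EuclideanSpace.single 1 w.2)
          (0, EuclideanSpace.single 1 1)) =
      c₁ * (∫ y in Iio (0 : ℝ), φ (0, EuclideanSpace.single 0 x + EuclideanSpace.single 1 y)) +
        c₂ * (∫ y in Ioi (0 : ℝ), φ (0, EuclideanSpace.single 0 x + EuclideanSpace.single 1 y)) +
        c₃ * (∫ t in Ioi (0 : ℝ),
          φ (t, EuclideanSpace.single 0 x + EuclideanSpace.single 1 (μ * t))) +
        c₄ * ∫ t in Ioi (0 : ℝ),
          φ (t, EuclideanSpace.single 0 x + EuclideanSpace.single 1 (ν * t)) := by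
    intro x
    have h := h2D _ (contDiff_slice hφ x) (hasCompactSupport_slice hφc x)
    simp only [fderiv_slice_fst hφ, fderiv_slice_snd hφ] at h
    exact h
  simp_rw [hx]
  have i1 := integrable_timeSlice_integral hφ.continuous hφc 0 (measurableSet_Iio (a := (0 : ℝ)))
  have i2 := integrable_timeSlice_integral hφ.continuous hφc 0 (measurableSet_Ioi (a := (0 : ℝ)))
  have i3 := integrable_raySlice_integral hφ.continuous hφc μ
  have i4 := integrable_raySlice_integral hφ.continuous hφc ν
  have j1 : Integrable (fun x : ℝ => c₁ * ∫ y in Iio (0 : ℝ),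
      φ (0, EuclideanSpace.single 0 x + EuclideanSpace.single 1 y)) := i1.const_mul c₁
  have j2 : Integrable (fun x : ℝ => c₂ * ∫ y in Ioi (0 : ℝ),
      φ (0, EuclideanSpace.single 0 x + EuclideanSpace.single 1 y)) := i2.const_mul c₂
  have j3 : Integrable (fun x : ℝ => c₃ * ∫ t in Ioi (0 : ℝ),
      φ (t, EuclideanSpace.single 0 x + EuclideanSpace.single 1 (μ * t))) := i3.const_mul c₃
  have j4 : Integrable (fun x : ℝ => c₄ * ∫ t in Ioi (0 : ℝ),
      φ (t, EuclideanSpace.single 0 x + EuclideanSpace.single 1 (ν * t))) := i4.const_mul c₄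
  have j12 : Integrable (fun x : ℝ => c₁ * (∫ y in Iio (0 : ℝ),
      φ (0, EuclideanSpace.single 0 x + EuclideanSpace.single 1 y)) + c₂ * ∫ y in Ioi (0 : ℝ),
      φ (0, EuclideanSpace.single 0 x + EuclideanSpace.single 1 y)) := j1.add j2
  have j123 : Integrable (fun x : ℝ => c₁ * (∫ y in Iio (0 : ℝ),
      φ (0, EuclideanSpace.single 0 x + EuclideanSpace.single 1 y)) + c₂ * (∫ y in Ioi (0 : ℝ),
      φ (0, EuclideanSpace.single 0 x + EuclideanSpace.single 1 y)) + c₃ * ∫ t in Ioi (0 : ℝ),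
      φ (t, EuclideanSpace.single 0 x + EuclideanSpace.single 1 (μ * t))) := j12.add j3
  rw [integral_add j123 j4, integral_add j12 j3, integral_add j1 j2,
    integral_const_mul, integral_const_mul, integral_const_mul, integral_const_mul]

/-- Lower half-wedge `Γ = {t > 0, y < μ t}`. [folklore] -/
theorem integral_fan_lower (hφ : ContDiff ℝ 1 φ) (hφc : HasCompactSupport φ) (μ q g f : ℝ) :
    ∫ z in {z : ℝ × EuclideanSpace ℝ (Fin 2) | 0 < z.1 ∧ z.2 1 < μ * z.1},
        (q * fderiv ℝ φ z (1, 0) + g * fderiv ℝ φ z (0, EuclideanSpace.single 0 1) +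
          f * fderiv ℝ φ z (0, EuclideanSpace.single 1 1)) =
      -q * (∫ x : ℝ, ∫ y in Iio (0 : ℝ),
          φ (0, EuclideanSpace.single 0 x + EuclideanSpace.single 1 y)) +
        (f - q * μ) * ∫ x : ℝ, ∫ t in Ioi (0 : ℝ),
          φ (t, EuclideanSpace.single 0 x + EuclideanSpace.single 1 (μ * t)) := by
  have h := integral_fanRegion_of_2D {p : ℝ × ℝ | 0 < p.1 ∧ p.2 < μ * p.1} hφ hφc q g f (-q) 0 (f - q * μ) 0 μ μ (fun Ψ hΨ hΨc => by
      rw [setIntegral_halfWedge hΨ hΨc]; ring)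
  rw [show {z : ℝ × EuclideanSpace ℝ (Fin 2) | 0 < z.1 ∧ z.2 1 < μ * z.1} =
    {z | (z.1, z.2 1) ∈ {p : ℝ × ℝ | 0 < p.1 ∧ p.2 < μ * p.1}} from rfl, h]
  ring

/-- Upper half-wedge `Γ = {t > 0, y > ν t}`. [folklore] -/
theorem integral_fan_upper (hφ : ContDiff ℝ 1 φ) (hφc : HasCompactSupport φ) (ν q g f : ℝ) :
    ∫ z in {z : ℝ × EuclideanSpace ℝ (Fin 2) | 0 < z.1 ∧ ν * z.1 < z.2 1},
        (q * fderiv ℝ φ z (1, 0) + g * fderiv ℝ φ z (0, EuclideanSpace.single 0 1) +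
          f * fderiv ℝ φ z (0, EuclideanSpace.single 1 1)) =
      -q * (∫ x : ℝ, ∫ y in Ioi (0 : ℝ),
          φ (0, EuclideanSpace.single 0 x + EuclideanSpace.single 1 y)) -
        (f - q * ν) * ∫ x : ℝ, ∫ t in Ioi (0 : ℝ),
          φ (t, EuclideanSpace.single 0 x + EuclideanSpace.single 1 (ν * t)) := by
  have h := integral_fanRegion_of_2D {p : ℝ × ℝ | 0 < p.1 ∧ ν * p.1 < p.2} hφ hφc q g f 0 (-q) 0 (-(f - q * ν)) ν ν
    (fun Ψ hΨ hΨc => by rw [setIntegral_upperHalfWedge hΨ hΨc]; ring)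
  rw [show {z : ℝ × EuclideanSpace ℝ (Fin 2) | 0 < z.1 ∧ ν * z.1 < z.2 1} =
    {z | (z.1, z.2 1) ∈ {p : ℝ × ℝ | 0 < p.1 ∧ ν * p.1 < p.2}} from rfl, h]
  ring

/-- Middle wedge `Γ = {t > 0, μ t < y < ν t}`. [folklore] -/
theorem integral_fan_middle (hφ : ContDiff ℝ 1 φ) (hφc : HasCompactSupport φ) {μ ν : ℝ}
    (hμν : μ < ν) (q g f : ℝ) :
    ∫ z in {z : ℝ × EuclideanSpace ℝ (Fin 2) | 0 < z.1 ∧ μ * z.1 < z.2 1 ∧ z.2 1 < ν * z.1},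
        (q * fderiv ℝ φ z (1, 0) + g * fderiv ℝ φ z (0, EuclideanSpace.single 0 1) +
          f * fderiv ℝ φ z (0, EuclideanSpace.single 1 1)) =
      (f - q * ν) * (∫ x : ℝ, ∫ t in Ioi (0 : ℝ),
          φ (t, EuclideanSpace.single 0 x + EuclideanSpace.single 1 (ν * t))) -
        (f - q * μ) * ∫ x : ℝ, ∫ t in Ioi (0 : ℝ),
          φ (t, EuclideanSpace.single 0 x + EuclideanSpace.single 1 (μ * t)) := by
  have h := integral_fanRegion_of_2D {p : ℝ × ℝ | 0 < p.1 ∧ μ * p.1 < p.2 ∧ p.2 < ν * p.1}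
    hφ hφc q g f 0 0 (-(f - q * μ)) (f - q * ν) μ ν
    (fun Ψ hΨ hΨc => by rw [setIntegral_midWedge hΨ hΨc hμν]; ring)
  rw [show {z : ℝ × EuclideanSpace ℝ (Fin 2) | 0 < z.1 ∧ μ * z.1 < z.2 1 ∧ z.2 1 < ν * z.1} =
    {z | (z.1, z.2 1) ∈ {p : ℝ × ℝ | 0 < p.1 ∧ μ * p.1 < p.2 ∧ p.2 < ν * p.1}} from rfl, h]
  ring

end region

/-! ### The fan identity (Rankine–Hugoniot bookkeeping) -/

section fan

variable {φ : ℝ × EuclideanSpace ℝ (Fin 2) → ℝ}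

/-- **Fan identity.** For a three-region fan `y < -σt`, `-σt < y < σt`, `y > σt` (`σ > 0`)
carrying the constant densities/fluxes `(q₋, g₋, f₋)`, `(q₁, g₁, f₁)`, `(q₊, g₊, f₊)` and the
Riemann initial datum `q₋ 1_{y<0} + q₊ 1_{y ≥ 0}`, the weak-form pairing with a test function
equals the Rankine–Hugoniot defects times the (non-negative) ray functionals. [cite: Markfelder2021, Prop. 8.3.5 (proof: Rankine–Hugoniot conditions ⇔ (8.12)–(8.15) for fan subsolutions)] [cite: ChiodaroliDeLellisKreml2015, Def. 3.3–3.5 and Prop. 3.6] -/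
theorem fan_identity (hφ : ContDiff ℝ 1 φ) (hφc : HasCompactSupport φ) {σ : ℝ} (hσ : 0 < σ)
    (qm gm fm q₁ g₁ f₁ qp gp fp : ℝ) :
    (∫ z in {z : ℝ × EuclideanSpace ℝ (Fin 2) | 0 < z.1 ∧ z.2 1 < -σ * z.1},
        (qm * fderiv ℝ φ z (1, 0) + gm * fderiv ℝ φ z (0, EuclideanSpace.single 0 1) +
          fm * fderiv ℝ φ z (0, EuclideanSpace.single 1 1))) +
    (∫ z in {z : ℝ × EuclideanSpace ℝ (Fin 2) | 0 < z.1 ∧ -σ * z.1 < z.2 1 ∧ z.2 1 < σ * z.1},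
        (q₁ * fderiv ℝ φ z (1, 0) + g₁ * fderiv ℝ φ z (0, EuclideanSpace.single 0 1) +
          f₁ * fderiv ℝ φ z (0, EuclideanSpace.single 1 1))) +
    (∫ z in {z : ℝ × EuclideanSpace ℝ (Fin 2) | 0 < z.1 ∧ σ * z.1 < z.2 1},
        (qp * fderiv ℝ φ z (1, 0) + gp * fderiv ℝ φ z (0, EuclideanSpace.single 0 1) +
          fp * fderiv ℝ φ z (0, EuclideanSpace.single 1 1))) +
    ∫ v : EuclideanSpace ℝ (Fin 2), (if v 1 < 0 then qm else qp) * φ (0, v) =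
      ((fm - f₁) + σ * (qm - q₁)) * (∫ x : ℝ, ∫ t in Ioi (0 : ℝ),
          φ (t, EuclideanSpace.single 0 x + EuclideanSpace.single 1 (-σ * t))) +
        ((f₁ - fp) + σ * (qp - q₁)) * ∫ x : ℝ, ∫ t in Ioi (0 : ℝ),
          φ (t, EuclideanSpace.single 0 x + EuclideanSpace.single 1 (σ * t)) := by
  rw [integral_fan_lower hφ hφc, integral_fan_middle hφ hφc (by linarith : -σ < σ),
    integral_fan_upper hφ hφc, integral_initial hφ.continuous hφc]
  ring

/-- The ray functional of a non-negative test function is non-negative. [folklore] -/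
theorem rayIntegral_nonneg (hφ0 : ∀ z, 0 ≤ φ z) (μ : ℝ) :
    0 ≤ ∫ x : ℝ, ∫ t in Ioi (0 : ℝ),
      φ (t, EuclideanSpace.single 0 x + EuclideanSpace.single 1 (μ * t)) :=
  integral_nonneg fun _ => setIntegral_nonneg measurableSet_Ioi fun _ _ => hφ0 _

/-- **Fan identity, conservative case**: under the two Rankine–Hugoniot conditions the weak
form vanishes. [cite: Markfelder2021, Prop. 8.3.5 ((8.20)–(8.31) ⇒ (8.12)–(8.14))] -/
theorem fan_weakForm_eq_zero (hφ : ContDiff ℝ 1 φ) (hφc : HasCompactSupport φ) {σ : ℝ}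
    (hσ : 0 < σ) {qm gm fm q₁ g₁ f₁ qp gp fp : ℝ}
    (h₁ : (fm - f₁) + σ * (qm - q₁) = 0) (h₂ : (f₁ - fp) + σ * (qp - q₁) = 0) :
    (∫ z in {z : ℝ × EuclideanSpace ℝ (Fin 2) | 0 < z.1 ∧ z.2 1 < -σ * z.1},
        (qm * fderiv ℝ φ z (1, 0) + gm * fderiv ℝ φ z (0, EuclideanSpace.single 0 1) +
          fm * fderiv ℝ φ z (0, EuclideanSpace.single 1 1))) +
    (∫ z in {z : ℝ × EuclideanSpace ℝ (Fin 2) | 0 < z.1 ∧ -σ * z.1 < z.2 1 ∧ z.2 1 < σ * z.1},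
        (q₁ * fderiv ℝ φ z (1, 0) + g₁ * fderiv ℝ φ z (0, EuclideanSpace.single 0 1) +
          f₁ * fderiv ℝ φ z (0, EuclideanSpace.single 1 1))) +
    (∫ z in {z : ℝ × EuclideanSpace ℝ (Fin 2) | 0 < z.1 ∧ σ * z.1 < z.2 1},
        (qp * fderiv ℝ φ z (1, 0) + gp * fderiv ℝ φ z (0, EuclideanSpace.single 0 1) +
          fp * fderiv ℝ φ z (0, EuclideanSpace.single 1 1))) +
    ∫ v : EuclideanSpace ℝ (Fin 2), (if v 1 < 0 then qm else qp) * φ (0, v) = 0 := by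
  rw [fan_identity hφ hφc hσ, h₁, h₂, zero_mul, zero_mul, add_zero]

/-- **Fan identity, dissipative case**: under the two Rankine–Hugoniot *inequalities* the weak
form against a non-negative test function is `≤ 0`. [cite: Markfelder2021, Prop. 8.3.5 ((8.34)–(8.36) ⇒ (8.15), via (8.42))] -/
theorem fan_weakForm_nonpos (hφ : ContDiff ℝ 1 φ) (hφc : HasCompactSupport φ)
    (hφ0 : ∀ z, 0 ≤ φ z) {σ : ℝ} (hσ : 0 < σ) {qm gm fm q₁ g₁ f₁ qp gp fp : ℝ}
    (h₁ : (fm - f₁) + σ * (qm - q₁) ≤ 0) (h₂ : (f₁ - fp) + σ * (qp - q₁) ≤ 0) :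
    (∫ z in {z : ℝ × EuclideanSpace ℝ (Fin 2) | 0 < z.1 ∧ z.2 1 < -σ * z.1},
        (qm * fderiv ℝ φ z (1, 0) + gm * fderiv ℝ φ z (0, EuclideanSpace.single 0 1) +
          fm * fderiv ℝ φ z (0, EuclideanSpace.single 1 1))) +
    (∫ z in {z : ℝ × EuclideanSpace ℝ (Fin 2) | 0 < z.1 ∧ -σ * z.1 < z.2 1 ∧ z.2 1 < σ * z.1},
        (q₁ * fderiv ℝ φ z (1, 0) + g₁ * fderiv ℝ φ z (0, EuclideanSpace.single 0 1) +
          f₁ * fderiv ℝ φ z (0, EuclideanSpace.single 1 1))) +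
    (∫ z in {z : ℝ × EuclideanSpace ℝ (Fin 2) | 0 < z.1 ∧ σ * z.1 < z.2 1},
        (qp * fderiv ℝ φ z (1, 0) + gp * fderiv ℝ φ z (0, EuclideanSpace.single 0 1) +
          fp * fderiv ℝ φ z (0, EuclideanSpace.single 1 1))) +
    ∫ v : EuclideanSpace ℝ (Fin 2), (if v 1 < 0 then qm else qp) * φ (0, v) ≤ 0 := by
  rw [fan_identity hφ hφc hσ]
  have hA := rayIntegral_nonneg hφ0 (-σ)
  have hB := rayIntegral_nonneg hφ0 σ
  nlinarith [mul_nonpos_of_nonpos_of_nonneg h₁ hA, mul_nonpos_of_nonpos_of_nonneg h₂ hB]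

/-! ### Splitting the space–time half-space into the fan regions -/

/-- The ray `{y = c t}` (a hyperplane of `ℝ × ℝ²`) is Lebesgue-null. [folklore] -/
theorem volume_ray_eq_zero (c : ℝ) :
    volume {z : ℝ × EuclideanSpace ℝ (Fin 2) | z.2 1 = c * z.1} = 0 := by
  let L : (ℝ × EuclideanSpace ℝ (Fin 2)) →ₗ[ℝ] ℝ :=
    (EuclideanSpace.proj (1 : Fin 2)).toLinearMap.comp (LinearMap.snd ℝ ℝ _) -
      c • LinearMap.fst ℝ ℝ _
  have hL : ∀ z : ℝ × EuclideanSpace ℝ (Fin 2), L z = z.2 1 - c * z.1 := fun z => by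
    simp [L]
  have hker : {z : ℝ × EuclideanSpace ℝ (Fin 2) | z.2 1 = c * z.1} = (LinearMap.ker L : Set _) := by
    ext z
    simp only [mem_setOf_eq, SetLike.mem_coe, LinearMap.mem_ker, hL]
    constructor <;> intro h <;> linarith
  have hne : LinearMap.ker L ≠ ⊤ := by
    intro h
    have : ((0 : ℝ), EuclideanSpace.single (1 : Fin 2) (1 : ℝ)) ∈ LinearMap.ker L := by
      rw [h]; exact Submodule.mem_top
    rw [LinearMap.mem_ker, hL] at this
    simp at this
  rw [hker]
  haveI : (volume : Measure (ℝ × EuclideanSpace ℝ (Fin 2))).IsAddHaarMeasure :=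
    Measure.prod.instIsAddHaarMeasure _ _
  exact Measure.addHaar_submodule volume _ hne

/-- The fan region `{t > 0, y < μ t}` of space–time is measurable. [folklore] -/
theorem measurableSet_fanLower (μ : ℝ) :
    MeasurableSet {z : ℝ × EuclideanSpace ℝ (Fin 2) | 0 < z.1 ∧ z.2 1 < μ * z.1} :=
  (isOpen_lt continuous_const continuous_fst).inter
    (isOpen_lt (by fun_prop) (continuous_const.mul continuous_fst)) |>.measurableSet

/-- The fan region `{t > 0, y > ν t}` of space–time is measurable. [folklore] -/
theorem measurableSet_fanUpper (ν : ℝ) :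
    MeasurableSet {z : ℝ × EuclideanSpace ℝ (Fin 2) | 0 < z.1 ∧ ν * z.1 < z.2 1} :=
  (isOpen_lt continuous_const continuous_fst).inter
    (isOpen_lt (continuous_const.mul continuous_fst) (by fun_prop)) |>.measurableSet

/-- The fan region `{t > 0, μ t < y < ν t}` of space–time is measurable. [folklore] -/
theorem measurableSet_fanMiddle (μ ν : ℝ) :
    MeasurableSet {z : ℝ × EuclideanSpace ℝ (Fin 2) | 0 < z.1 ∧ μ * z.1 < z.2 1 ∧ z.2 1 < ν * z.1} :=
  (isOpen_lt continuous_const continuous_fst).inter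
    ((isOpen_lt (continuous_const.mul continuous_fst) (by fun_prop)).inter
      (isOpen_lt (by fun_prop) (continuous_const.mul continuous_fst))) |>.measurableSet

/-- The fan region `{t > 0, μ t < y < ν t}` of space–time is open. [folklore] -/
theorem isOpen_fanMiddle (μ ν : ℝ) :
    IsOpen {z : ℝ × EuclideanSpace ℝ (Fin 2) | 0 < z.1 ∧ μ * z.1 < z.2 1 ∧ z.2 1 < ν * z.1} :=
  (isOpen_lt continuous_const continuous_fst).inter
    ((isOpen_lt (continuous_const.mul continuous_fst) (by fun_prop)).inter
      (isOpen_lt (by fun_prop) (continuous_const.mul continuous_fst)))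

/-- The half-space `{t > 0}` is, up to the two null rays `y = ∓σ t`, the disjoint union of the
three fan regions. [cite: Markfelder2021, Def. 8.3.2 (fan partition)] -/
theorem halfSpace_ae_eq_fan (σ : ℝ) :
    (Ioi (0 : ℝ) ×ˢ (univ : Set (EuclideanSpace ℝ (Fin 2))) : Set (ℝ × EuclideanSpace ℝ (Fin 2)))
      =ᵐ[volume]
      (({z : ℝ × EuclideanSpace ℝ (Fin 2) | 0 < z.1 ∧ z.2 1 < -σ * z.1} ∪
        {z | 0 < z.1 ∧ -σ * z.1 < z.2 1 ∧ z.2 1 < σ * z.1}) ∪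
        {z | 0 < z.1 ∧ σ * z.1 < z.2 1} : Set (ℝ × EuclideanSpace ℝ (Fin 2))) := by
  have hsub : (({z : ℝ × EuclideanSpace ℝ (Fin 2) | 0 < z.1 ∧ z.2 1 < -σ * z.1} ∪
        {z | 0 < z.1 ∧ -σ * z.1 < z.2 1 ∧ z.2 1 < σ * z.1}) ∪
        {z | 0 < z.1 ∧ σ * z.1 < z.2 1} : Set (ℝ × EuclideanSpace ℝ (Fin 2))) ⊆
      Ioi (0 : ℝ) ×ˢ (univ : Set (EuclideanSpace ℝ (Fin 2))) := by
    rintro z ((⟨h, -⟩ | ⟨h, -⟩) | ⟨h, -⟩) <;> exact ⟨h, mem_univ _⟩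
  refine (ae_eq_set.mpr ⟨?_, ?_⟩).symm
  · rw [sdiff_eq_empty.mpr hsub]; exact measure_empty
  · refine measure_mono_null (t := {z : ℝ × EuclideanSpace ℝ (Fin 2) | z.2 1 = -σ * z.1} ∪
      {z | z.2 1 = σ * z.1}) ?_ ?_
    · rintro z ⟨⟨ht, -⟩, hz⟩
      simp only [mem_union, mem_setOf_eq, not_or, not_and, not_lt] at hz
      obtain ⟨⟨h1, h2⟩, h3⟩ := hz
      rcases lt_trichotomy (z.2 1) (-σ * z.1) with h | h | h
      · exact absurd h (not_lt.mpr (h1 ht))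
      · exact Or.inl h
      · rcases lt_trichotomy (z.2 1) (σ * z.1) with h' | h' | h'
        · exact absurd h' (not_lt.mpr (h2 ht h))
        · exact Or.inr h'
        · exact absurd h' (not_lt.mpr (h3 ht))
    · exact measure_union_null (volume_ray_eq_zero (-σ)) (volume_ray_eq_zero σ)

/-- Splitting an integral over `{t > 0}` into the three fan regions. [cite: Markfelder2021, Def. 8.3.2 (fan partition)] -/
theorem setIntegral_halfSpace_eq_fan {σ : ℝ} (hσ : 0 < σ) {F : ℝ × EuclideanSpace ℝ (Fin 2) → ℝ}
    (hF : IntegrableOn F (Ioi (0 : ℝ) ×ˢ (univ : Set (EuclideanSpace ℝ (Fin 2))))) :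
    ∫ z in Ioi (0 : ℝ) ×ˢ (univ : Set (EuclideanSpace ℝ (Fin 2))), F z =
      (∫ z in {z : ℝ × EuclideanSpace ℝ (Fin 2) | 0 < z.1 ∧ z.2 1 < -σ * z.1}, F z) +
      (∫ z in {z : ℝ × EuclideanSpace ℝ (Fin 2) | 0 < z.1 ∧ -σ * z.1 < z.2 1 ∧ z.2 1 < σ * z.1},
        F z) +
      ∫ z in {z : ℝ × EuclideanSpace ℝ (Fin 2) | 0 < z.1 ∧ σ * z.1 < z.2 1}, F z := by
  rw [setIntegral_congr_set (halfSpace_ae_eq_fan σ)]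
  have hm : IntegrableOn F {z : ℝ × EuclideanSpace ℝ (Fin 2) | 0 < z.1 ∧ z.2 1 < -σ * z.1} :=
    hF.mono_set (fun z ⟨h, _⟩ => ⟨h, mem_univ _⟩)
  have h1 : IntegrableOn F
      {z : ℝ × EuclideanSpace ℝ (Fin 2) | 0 < z.1 ∧ -σ * z.1 < z.2 1 ∧ z.2 1 < σ * z.1} :=
    hF.mono_set (fun z ⟨h, _⟩ => ⟨h, mem_univ _⟩)
  have hp : IntegrableOn F {z : ℝ × EuclideanSpace ℝ (Fin 2) | 0 < z.1 ∧ σ * z.1 < z.2 1} :=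
    hF.mono_set (fun z ⟨h, _⟩ => ⟨h, mem_univ _⟩)
  rw [setIntegral_union _ (measurableSet_fanUpper σ) (hm.union h1) hp,
    setIntegral_union _ (measurableSet_fanMiddle (-σ) σ) hm h1]
  · rw [Set.disjoint_left]
    rintro z ⟨-, hz⟩ ⟨ht, hz', -⟩
    exact absurd (hz.trans hz') (lt_irrefl _)
  · rw [Set.disjoint_left]
    rintro z (⟨ht, hz⟩ | ⟨ht, -, hz⟩) ⟨-, hz'⟩
    · have : -σ * z.1 < σ * z.1 := by nlinarith
      exact absurd (hz.trans (this.trans hz')) (lt_irrefl _)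
    · exact absurd (hz.trans hz') (lt_irrefl _)

end fan

end Literature.Analysis.FluidPDE.FanPartition
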